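import Literature.Analysis.FluidPDE.TorusStrainProjection
import Literature.Analysis.FunctionSpaces.TorusWienerSobolevInterpolation
import Literature.Analysis.FunctionSpaces.TorusVectorParseval
import Literature.Analysis.FunctionSpaces.TorusFourierModes
import Literature.Analysis.FluidPDE.TorusStrainVorticityOrthogonality
import Literature.Analysis.FluidPDE.TorusNSStrainAlmostEigenCriterion
import Literature.Analysis.FluidPDE.TorusClassicalHnBalance
import Literature.Analysis.FunctionSpaces.TorusConvectionLaplacianNormSq
import HarnessLib

/-!
# Miller's perturbative regularity criteria in terms of `P_{st}((u·∇)S + S² + ¾ω⊗ω)`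
# (Pure Appl. Anal. 8 (2026), Thms 1.8–1.9), classical solutions on `T³`

Analysis/FluidPDE proof file (one cited definition with body — the matrix field
`Torus.strainPerturbation` — and theorems; no named facts).
Search for candidate a priori estimates; no regularity claim.

E. Miller, *On the interaction of strain and vorticity for solutions of the Navier–Stokes equation*,
Pure Appl. Anal. 8 (2026) 247–270 = arXiv:2407.02691, writes the Navier–Stokes strain equation as a
perturbation of the (globally regular, Thm 1.2) strain–vorticity interaction model,
`∂ₜS − ΔS − ½P_{st}(ω⊗ω) + Q = 0`, `Q := P_{st}((u·∇)S + S² + ¾ω⊗ω)` ((5.9), (5.11)), and proves: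

* **Theorem 1.8 (= Thm 5.3).** "Suppose `u ∈ C([0,T_max);H³_{df})` is a mild solution of the
  Navier–Stokes equation. Suppose `0 ≤ α ≤ 1` and `p = 2/(1+α)`. Then for all `0 < t < T_max`,
  `‖S(·,t)‖²_{Ḣ¹} ≤ ‖S⁰‖²_{Ḣ¹} exp(C_α ∫₀ᵗ ‖P_{st}((u·∇)S + S² + ¾ω⊗ω)(·,τ)‖^p_{Ḣ^α}/‖S(·,τ)‖^p_{Ḣ¹} dτ)`,
  where `C_α` depends only on `α`. In particular, if `T_max < +∞`, then
  `∫₀^{T_max} ‖P_{st}(…)‖^p_{Ḣ^α}/‖S‖^p_{Ḣ¹} dt = +∞`." Printed constants: `C₀ = ½`, `C₁ = 2`.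
* **Theorem 1.9 (= Thm 5.4).** "… Then if `T_max < +∞`, then
  `limsup_{t→T_max} ‖P_{st}((u·∇)S + S² + ¾ω⊗ω)(·,t)‖_{L²}/‖−ΔS(·,t)‖_{L²} ≥ 1`."

Printed proof (§5): `⟨−ΔS, ω⊗ω⟩ = 0` (Thm 1.3; tree `TorusStrainVorticityOrthogonality`) turns the
strain equation into `d/dt ½‖S‖²_{Ḣ¹} = −‖−ΔS‖² − ⟨−ΔS, Q⟩` ((5.10)); then Hölder + Young
(`α = 0`: `≤ ¼‖Q‖²`, so `d/dt‖S‖²_{Ḣ¹} ≤ ½(‖Q‖²/‖S‖²_{Ḣ¹})‖S‖²_{Ḣ¹}`), `Ḣ¹`–`Ḣ⁻¹` duality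
(`α = 1`: `≤ ‖Q‖_{Ḣ¹}‖S‖_{Ḣ¹}`), interpolation for `0 < α < 1`, Grönwall; for Thm 1.9 the ratio
`< 1` near `T_max` makes `‖S‖_{Ḣ¹}` non-increasing, contradicting blow-up of the subcritical norm.

Here, on the unit torus `T^d`, `card d = 3` (curl read in a frame `e : d ≃ Fin 3`,
`ωₐ = W_{e⁻¹(e a+1), e⁻¹(e a+2)}`), for CLASSICAL solutions of the unforced system
(`Torus.IsClassicalNSSolutionOn … ν 0 u p`, viscosity `ν` kept explicit: the strain equation reads
`∂ₜS − νΔS + P_{st}(…) = 0`, so `C₀ = (2ν)⁻¹`, `C₁ = 2`, and the Thm 1.9 threshold is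
`‖Q‖_{L²} ≤ ν‖ΔS‖_{L²}`), in the ladder variables of the cell's other files
(`‖S‖²_{Ḣ¹} = ½‖Δu‖₂²`, `‖ΔS‖²_{L²} = ½‖∇Δu‖₂²`: torus strain isometries, Miller Prop 2.5, tree
`StrainAlmostEigen.integral_sum_laplacianStrain_sq_eq`), with `P_{st}` the explicit smooth operator of
`TorusStrainProjection` and

* `Torus.strainPerturbation e v` — the matrix field `M = (v·∇)S + S² + ¾ω⊗ω`
  (`M_{ab} = ∑_c v_c∂_cS_{ab} + ∑_c S_{ac}S_{cb} + ¾ωₐω_b`), so that `Q = P_{st}M = Torus.strainProjection M`;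

we prove (theorems only; `(ΔS)_{ij} = ½((∂ᵢΔu)ⱼ + (∂ⱼΔu)ᵢ)`):

* statics (namespace `StrainProjectionCriterion`): `sum_partialDeriv_strain_eq_half_laplacian`
  (`div S = ½Δw` for `div w = 0`), `symGrad_convect_apply` (**`∇_{sym}((v·∇)v) = (v·∇)S + S² + ¼W²`**,
  every `d`; eq. (1.4)), `integral_sum_laplacianStrain_mul_symGrad_eq` (`⟨ΔS, ∇_{sym}F⟩ = −½⟨Δ²v, F⟩`),
  **`integral_inner_convect_bilaplacian_eq`** (`∫⟪(v·∇)v, Δ²v⟫ = −2⟨ΔS, M⟩` on `T³`: the inertial term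
  of the `Ḣ²` balance IS Miller's `−2⟨−ΔS, (u·∇)S + S² + ¾ω⊗ω⟩`, via Thm 1.3 and `tr ΔS = 0`),
  `integral_sum_laplacianStrain_mul_strainProjection_eq` (`⟨ΔS, P_{st}M⟩ = ⟨ΔS, M⟩`: the projection may be
  inserted because `ΔS = ∇_{sym}Δv ∈ L²_{st}`), the flux bounds `strainH1Flux_le_sq`
  (`−ν‖∇Δv‖² + 2⟨ΔS,Q⟩ ≤ (2ν)⁻¹‖Q‖²`), `strainH1Flux_le_sqrt_mul_grad` (`≤ 2(½‖Δv‖²)^{1/2}‖∇Q‖`),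
  `strainH1Flux_nonpos_of_le` (`≤ 0` when `‖Q‖ ≤ ν‖ΔS‖`), and `sum_integral_sum_partialDeriv_strain_sq_eq`
  (`‖∇S‖² = ½‖Δv‖²`);
* **`Torus.IsClassicalNSSolutionOn.hasDerivWithinAt_half_laplacianSq_strainProjection`** — Miller's
  (5.10) along classical solutions: `s ↦ ½‖Δu(s)‖₂²` has one-sided derivative
  `−ν‖∇Δu‖₂² + 2∫∑(ΔS)_{ij}Q_{ij}` within `[a, b]`;
* **Thm 1.8, `α = 0`**: `Torus.half_laplacianSq_le_mul_exp_integral_of_strainProjection_sq_le` (Grönwall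
  form, `C₀ = (2ν)⁻¹`) and `Torus.classicalNS_continuation_of_strainProjection_sq_integral_le`
  (continuation form of "`∫₀^{T_max} … = +∞`");
* **Thm 1.8, `α = 1`**: `Torus.half_laplacianSq_le_mul_exp_integral_of_strainProjection_grad_le` (`C₁ = 2`)
  and `Torus.classicalNS_continuation_of_strainProjection_grad_integral_le`;
* **Thm 1.9**: `Torus.classicalNS_continuation_of_strainProjection_le` — if `‖Q(t)‖_{L²} ≤ ν‖ΔS(t)‖_{L²}`
  for all `t ∈ [t₀, T)` then the classical solution on `[0, T)` continues past `T`;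
* **Thm 1.8, `0 < α < 1`** (v2 append, Fourier side): `Torus.matrixHsSeminormSq s M` — the `Ḣˢ`
  seminorm (squared) of a matrix field in Miller's normalisation `∑ₐ ∑ₖ (2π|k|)^{2s}‖𝓕(Mₐ.)(k)‖²`
  (levels: `Torus.matrixHsSeminormSq_zero` = `‖M‖²_{L²}`, `…_one` = `‖∇M‖²_{L²}`, `…_one_symGrad` =
  `½‖Δv‖₂² = ‖S‖²_{Ḣ¹}`, `…_two_symGrad` = `‖ΔS‖²_{L²}`); `StrainProjectionCriterion.strainH1Flux_le_frac`
  (`−ν‖∇Δv‖² + 2⟨ΔS, Q⟩ ≤ C_α(ν) (‖S‖²_{Ḣ¹})^{α/(1+α)} ‖Q‖^{2/(1+α)}_{Ḣ^α}` by the `Ḣ^{−α}`–`Ḣ^{α}`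
  duality, the lattice interpolation `‖ΔS‖²_{Ḣ^{−α}} ≤ (‖S‖²_{Ḣ¹})^α (‖ΔS‖²_{L²})^{1−α}` and Young with
  `p = 2/(1+α)`, `q = 2/(1−α)`; explicit `C_α(ν) = (1+α)((1−α)/(2ν))^{(1−α)/(1+α)}`, `= (2ν)⁻¹` at
  `α = 0`), `Torus.half_laplacianSq_le_mul_exp_integral_of_strainProjection_frac_le` (Grönwall form) and
  `Torus.classicalNS_continuation_of_strainProjection_frac_integral_le` (continuation form);
* tool: `Torus.classicalNS_continuation_of_half_laplacianSq_le` (continuation from a bound on `½‖Δu‖₂²`,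
  via `‖∇u‖² ≤ ½‖Δu‖² + ½‖u‖²`, energy decay and RRS Lemma 6.11).

Scope (faithfulness): the printed setting is mild `H³` solutions on `ℝ³` with `ν = 1`; here classical
solutions with mean-zero slices on the unit torus (the census setting; all steps are integrations by
parts, identical on `T³` — Miller states for the companion ARMA results that they "apply equally on the
torus"), `ν > 0` explicit. The cases `0 < α < 1` of Thm 1.8 carry the explicit constant produced by the
printed Young step (the paper only records that `C_α` depends on `α`); the `Ḣ^α` seminorm of the matrix
field `Q` is read on the Fourier side (`Torus.matrixHsSeminormSq`). TODO(general form): Thm 1.10 (the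
blow-up side, perturbing the strain self-amplification model) is not typed.
Nothing about regularity of Navier–Stokes follows beyond the printed criteria; these are conditional
continuation statements and exact identities.

These serve the functional-mining cell (pub-nsfunc): CRITERIA row A25 (the `Ḣ¹`-level projected
nonlinearity `‖P_{st}((u·∇)S + S² + ¾ω⊗ω)‖` as an admissible right-hand side at palinstrophy level; queue
item (β) of NEXT.md since gen 22) and the dictionary's strain family (the exact identity
`½ d/dt‖Δu‖² = −ν‖∇Δu‖² + 2⟨ΔS, P_{st}M⟩` as a census row template at the `H₂` rung).

## Mathlib / tree search

Tree (used): `Torus.strainProjection` and its API (`TorusStrainProjection`, this seat);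
`StrainVorticityOrthogonality.integral_sum_laplacian_strain_mul_vorticityTensor_sq_eq_zero`,
`….integral_sum_vorticity_laplacianStrain_vorticity_eq_zero`, `laplacian_strain_apply`
(`TorusStrainVorticityOrthogonality`, Miller Thm 1.3); `StrainAlmostEigen.integral_sum_laplacianStrain_sq_eq`,
`….integral_sum_strain_mul_laplacianStrain_eq` (`TorusNSStrainAlmostEigenCriterion`);
`Torus.IsClassicalNSSolutionOn.hasDerivWithinAt_half_integral_norm_sq_laplacian_iterate`
(`TorusClassicalHnBalance`, `n = 1`); `Torus.partialDeriv_convect_eq_add_convect`,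
`Torus.convect_eq_sum_smul_partialDeriv`; `Torus.classicalNS_continuation_of_gradNormSq_le`
(`TorusNSEnstrophyContinuation`, RRS Lemma 6.11); `le_mul_exp_integral_of_hasDerivWithinAt_le_mul`,
`kineticEnergy_le_of_le` (`ExtremeGrowthVorticityControl`); `Torus.integral_inner_laplacian_self_eq_neg_gradNormSq`,
`Torus.integral_mul_laplacian_eq_neg_sum`, `Torus.IsDivFree.laplacian_of_isSmooth`; for `0 < α < 1`:
`Torus.tsum_rpow_mul_le_interpolate` (`TorusWienerSobolevInterpolation`, lattice Hölder interpolation),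
`hasSum_re_inner_mFourierCoeff_complexify`, `hasSum_sq_norm_mFourierCoeff_complexify` (`TorusVectorParseval`),
`mFourierCoeff_complexify_laplacian` (`TorusFourierModes`), `mFourierCoeff_complexify_partialDeriv`
(`TorusTrigPoly`), `IsSmooth.summable_freqNormSq_rpow_mul_norm_sq` (`TorusFractionalSobolevEmbedding`),
Mathlib `Real.inner_le_Lp_mul_Lq_tsum_of_nonneg`, `Real.sum_sqrt_mul_sqrt_le`, `Real.young_inequality_of_nonneg`;
the spectral identities `∑ 4π²|k|²‖v̂‖² = ‖∇v‖²`, `∑ (4π²|k|²)²‖v̂‖² = ‖Δv‖²` are private copies of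
`NSGevrey.hasSum_freqNormSq_mul_norm_sq_mFourierCoeff` / `…_sq_mul_…` (`TorusNSGevreySums`, not imported
to keep the import closure light). Searched
(`lean search`): `Thm 1\.9|P_st|strainProjection|strainPerturbation` — nothing before this seat's
`TorusStrainProjection`.

## References

* [Miller2026StrainVorticity] E. Miller, Pure Appl. Anal. 8 (2026), no. 1, 247–270,
  doi:10.2140/paa.2026.8.247 = arXiv:2407.02691: eq. (1.4), Thm 1.3, Thms 1.8–1.9 = Thms 5.3–5.4 with
  proofs, (5.9)–(5.11), Prop 2.5 (held text paper:arxiv-2407.02691, chunks 3–5, 13–14).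
* [Miller2019] E. Miller, Arch. Ration. Mech. Anal. 235 (2020) 99–139: Def 2.2, Prop 2.3, (2.7).
* [Miller2023StrainModel] E. Miller, Anal. PDE 16 (2023) 997–1032: Def 1.2, Prop 1.5 (proof: dropping
  `P_{st}` against `S ∈ L²_{st}`), eq. (1.9).
* [RobinsonRodrigoSadowskiCUP2016] Lemma 6.11 (continuation of classical solutions).
* [Grafakos2014] L. Grafakos, Classical Fourier Analysis, 3rd ed., Prop. 3.2.7 (3) (Parseval on `𝐓ⁿ`),
  Prop. 3.2.6 (8) (`𝓕(∂ⱼf)(k) = 2πi kⱼ f̂(k)`): the normalisation of `Torus.matrixHsSeminormSq`.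
-/

noncomputable section

open MeasureTheory Set Function Finset intervalIntegral
open scoped ContDiff InnerProductSpace RealInnerProductSpace

namespace Literature.Analysis.FluidPDE

open Literature.Analysis.FunctionSpaces StrainVorticityOrthogonality

variable {d : Type*} [Fintype d] [DecidableEq d]

/-! ### Miller's perturbation field `(u·∇)S + S² + ¾ ω⊗ω` -/

/-- **Miller's strain perturbation field** on `T³`: for a vector field `v` (`card d = 3`, curl read in
the frame `e : d ≃ Fin 3`, `ωₐ = W_{e⁻¹(e a+1), e⁻¹(e a+2)}`, `W_{ij} = (∂ᵢv)ⱼ − (∂ⱼv)ᵢ`), with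
`S_{ab} = ½((∂_b v)_a + (∂_a v)_b)`:

  `M_{ab} = ∑_c v_c ∂_c S_{ab} + ∑_c S_{ac}S_{cb} + ¾ ωₐω_b = ((v·∇)S + S² + ¾ω⊗ω)_{ab}`,

the matrix field whose strain projection `Q = P_{st}((u·∇)S + S² + ¾ω⊗ω)` measures, in Miller,
Pure Appl. Anal. 8 (2026), Thms 1.8–1.9 (proof of Thm 5.3, display "let `Q = P_{st}((u·∇)S + S² + ¾ω⊗ω)`"),
the distance of the Navier–Stokes strain equation `∂ₜS − ΔS − ½P_{st}(ω⊗ω) + Q = 0` ((5.9)) from the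
globally regular strain–vorticity interaction model. [cite: Miller2026StrainVorticity, Thm 1.8 and proof of Thm 5.3 (definition of `Q`)] -/
def Torus.strainPerturbation (e : d ≃ Fin 3) (v : UnitAddTorus d → EuclideanSpace ℝ d) (a b : d)
    (x : UnitAddTorus d) : ℝ :=
  (∑ c, v x c * Torus.partialDeriv c
      (fun y => (Torus.partialDeriv b v y a + Torus.partialDeriv a v y b) / 2) x) +
    (∑ c, ((Torus.partialDeriv c v x a + Torus.partialDeriv a v x c) / 2) *
      ((Torus.partialDeriv b v x c + Torus.partialDeriv c v x b) / 2)) +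
    3 / 4 * (torusVorticityTensor v (e.symm (e a + 1)) (e.symm (e a + 2)) x *
      torusVorticityTensor v (e.symm (e b + 1)) (e.symm (e b + 2)) x)

namespace StrainProjectionCriterion

/-! ### Smoothness and calculus helpers -/

omit [DecidableEq d] in
/-- Finite sums of smooth scalar functions are smooth. [folklore] -/
private theorem isSmooth_sum' {ι : Type*} (s : Finset ι) {g : ι → UnitAddTorus d → ℝ}
    (hg : ∀ i ∈ s, Torus.IsSmooth (g i)) : Torus.IsSmooth (fun x => ∑ i ∈ s, g i x) := by
  have hl : Torus.lift (fun x => ∑ i ∈ s, g i x) = fun z => ∑ i ∈ s, Torus.lift (g i) z := rfl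
  unfold Torus.IsSmooth
  rw [hl]
  exact ContDiff.sum fun i hi => hg i hi

omit [DecidableEq d] in
/-- Products of smooth scalar functions are smooth. [folklore] -/
private theorem smooth_mul' {a b : UnitAddTorus d → ℝ} (ha : Torus.IsSmooth a) (hb : Torus.IsSmooth b) :
    Torus.IsSmooth (fun y => a y * b y) := ha.mul hb

omit [DecidableEq d] in
/-- Constant multiples of smooth scalar functions are smooth. [folklore] -/
private theorem smooth_const_mul' (c : ℝ) {a : UnitAddTorus d → ℝ} (ha : Torus.IsSmooth a) :
    Torus.IsSmooth (fun y => c * a y) := (Torus.isSmooth_const c).mul ha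

omit [DecidableEq d] in
/-- Squares of smooth scalar functions are smooth. [folklore] -/
private theorem smooth_sq' {a : UnitAddTorus d → ℝ} (ha : Torus.IsSmooth a) :
    Torus.IsSmooth (fun y => a y ^ 2) := ha.pow 2

/-- The strain entries `S_{ab} = ½((∂_b v)_a + (∂_a v)_b)` of a smooth field are smooth. [folklore] -/
private theorem isSmooth_strain {v : UnitAddTorus d → EuclideanSpace ℝ d} (hv : Torus.IsSmooth v) (a b : d) :
    Torus.IsSmooth (fun y => (Torus.partialDeriv b v y a + Torus.partialDeriv a v y b) / 2) :=
  (((hv.partialDeriv b).apply a).add ((hv.partialDeriv a).apply b)).div_const 2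

/-- `Wᵢⱼ` of a smooth field is smooth. [folklore] -/
private theorem isSmooth_W {v : UnitAddTorus d → EuclideanSpace ℝ d} (hv : Torus.IsSmooth v) (i j : d) :
    Torus.IsSmooth (torusVorticityTensor v i j) :=
  ((hv.partialDeriv i).apply j).sub ((hv.partialDeriv j).apply i)

/-- The perturbation field of a smooth `v` is smooth. [cite: Miller2026StrainVorticity, Thm 1.8 (the field `(u·∇)S + S² + ¾ω⊗ω`)] -/
theorem _root_.Literature.Analysis.FluidPDE.Torus.isSmooth_strainPerturbation (e : d ≃ Fin 3)
    {v : UnitAddTorus d → EuclideanSpace ℝ d} (hv : Torus.IsSmooth v) (a b : d) :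
    Torus.IsSmooth (Torus.strainPerturbation e v a b) := by
  have hvc : ∀ c, Torus.IsSmooth (fun y => v y c) := fun c => hv.apply c
  have hS := isSmooth_strain hv
  have h1 : Torus.IsSmooth (fun x => ∑ c, v x c * Torus.partialDeriv c
      (fun y => (Torus.partialDeriv b v y a + Torus.partialDeriv a v y b) / 2) x) :=
    isSmooth_sum' _ fun c _ => smooth_mul' (hvc c) ((hS a b).partialDeriv c)
  have h2 : Torus.IsSmooth (fun x => ∑ c, ((Torus.partialDeriv c v x a + Torus.partialDeriv a v x c) / 2) *
      ((Torus.partialDeriv b v x c + Torus.partialDeriv c v x b) / 2)) :=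
    isSmooth_sum' _ fun c _ => smooth_mul' (hS a c) (hS c b)
  have h3 : Torus.IsSmooth (fun x => 3 / 4 * (torusVorticityTensor v (e.symm (e a + 1)) (e.symm (e a + 2)) x *
      torusVorticityTensor v (e.symm (e b + 1)) (e.symm (e b + 2)) x)) :=
    smooth_const_mul' _ (smooth_mul' (isSmooth_W hv _ _) (isSmooth_W hv _ _))
  have h : Torus.IsSmooth (fun x => (∑ c, v x c * Torus.partialDeriv c
      (fun y => (Torus.partialDeriv b v y a + Torus.partialDeriv a v y b) / 2) x) +
    (∑ c, ((Torus.partialDeriv c v x a + Torus.partialDeriv a v x c) / 2) *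
      ((Torus.partialDeriv b v x c + Torus.partialDeriv c v x b) / 2)) +
    3 / 4 * (torusVorticityTensor v (e.symm (e a + 1)) (e.symm (e a + 2)) x *
      torusVorticityTensor v (e.symm (e b + 1)) (e.symm (e b + 2)) x)) := (h1.add h2).add h3
  exact h

/-- `(Δu)_b = Δ(u_b)` for a smooth field. [folklore] -/
private theorem laplacian_apply_eq_laplacian_coord' {u : UnitAddTorus d → EuclideanSpace ℝ d}
    (hu : Torus.IsSmooth u) (b : d) (x : UnitAddTorus d) :
    Torus.laplacian u x b = Torus.laplacian (fun y => u y b) x := by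
  have := Torus.laplacian_clm_comp_apply hu (EuclideanSpace.proj b : EuclideanSpace ℝ d →L[ℝ] ℝ) x
  simpa [Function.comp_def] using this.symm

/-- `(Δu)_b(x) = ∑ₐ ∂ₐ(∂ₐu)_b (x)` for a smooth field. [folklore] -/
private theorem laplacian_apply_eq_sum' {u : UnitAddTorus d → EuclideanSpace ℝ d}
    (hu : Torus.IsSmooth u) (b : d) (x : UnitAddTorus d) :
    Torus.laplacian u x b = ∑ a, Torus.partialDeriv a (fun y => Torus.partialDeriv a u y b) x := by
  rw [laplacian_apply_eq_laplacian_coord' hu b x,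
    Torus.laplacian_eq_sum_partialDeriv_partialDeriv (hu.apply b)]
  refine Finset.sum_congr rfl fun a _ => ?_
  have e : Torus.partialDeriv a (fun y => u y b) = fun y => Torus.partialDeriv a u y b := by
    funext y; exact Torus.partialDeriv_apply_coord (hu.isContDiff (by simp)) a y b
  rw [e]

/-- `∑ₐ ∂ₐ(∂_b u)ₐ = 0` pointwise for a smooth divergence-free field (`= ∂_b div u`). [folklore] -/
private theorem sum_partialDeriv_partialDeriv_apply_eq_zero' {u : UnitAddTorus d → EuclideanSpace ℝ d}
    (hu : Torus.IsSmooth u) (hdiv : Torus.IsDivFree u) (b : d) (x : UnitAddTorus d) :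
    ∑ a, Torus.partialDeriv a (fun y => Torus.partialDeriv b u y a) x = 0 := by
  have hu1 : Torus.IsContDiff 1 u := hu.isContDiff (by simp)
  have hD1 : ∀ m, Torus.IsContDiff 1 (Torus.partialDeriv m u) := fun m =>
    (hu.partialDeriv m).isContDiff (by simp)
  have hDc1 : ∀ m j, Torus.IsContDiff 1 (fun y => Torus.partialDeriv m u y j) := fun m j =>
    ((hu.partialDeriv m).apply j).isContDiff (by simp)
  have h1 : ∀ a, Torus.partialDeriv a (fun y => Torus.partialDeriv b u y a) x =
      Torus.partialDeriv b (fun y => Torus.partialDeriv a u y a) x := by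
    intro a
    rw [Torus.partialDeriv_apply_coord (hD1 b), Torus.partialDeriv_apply_coord (hD1 a),
      Torus.partialDeriv_comm hu a b x]
  simp_rw [h1]
  rw [← Torus.partialDeriv_finset_sum Finset.univ (fun a _ => hDc1 a a)]
  have hdivfun : (fun y => ∑ a, Torus.partialDeriv a u y a) = fun _ => (0 : ℝ) := by
    funext y
    rw [← Torus.divergence_eq_sum_partialDeriv_apply hu1]
    exact hdiv y
  rw [hdivfun]
  simp [Torus.partialDeriv, Torus.lineDeriv]

/-- Integration by parts for one partial derivative: `∫ (∂ᵢa) b = −∫ a (∂ᵢb)`. [folklore] -/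
private theorem integral_partialDeriv_mul_eq_neg' {a b : UnitAddTorus d → ℝ} (ha : Torus.IsSmooth a)
    (hb : Torus.IsSmooth b) (i : d) :
    ∫ x, Torus.partialDeriv i a x * b x = -∫ x, a x * Torus.partialDeriv i b x := by
  have h0 : ∫ x, Torus.partialDeriv i (fun y => a y * b y) x = 0 :=
    Torus.integral_partialDeriv_eq_zero_holds (smooth_mul' ha hb) i
  simp_rw [Torus.partialDeriv_mul (ha.isContDiff (by simp)) (hb.isContDiff (by simp))] at h0
  rw [integral_add (smooth_mul' ha (hb.partialDeriv i)).integrable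
    (smooth_mul' (ha.partialDeriv i) hb).integrable] at h0
  linarith

/-- The partial derivatives of the strain entries: `∂_c S_{ab} = ½((∂_c∂_b v)_a + (∂_c∂_a v)_b)`. [folklore] -/
private theorem partialDeriv_strain {v : UnitAddTorus d → EuclideanSpace ℝ d} (hv : Torus.IsSmooth v)
    (a b c : d) (x : UnitAddTorus d) :
    Torus.partialDeriv c (fun y => (Torus.partialDeriv b v y a + Torus.partialDeriv a v y b) / 2) x =
      (Torus.partialDeriv c (Torus.partialDeriv b v) x a + Torus.partialDeriv c (Torus.partialDeriv a v) x b) / 2 := by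
  have hA : Torus.IsContDiff 1 (fun y => Torus.partialDeriv b v y a) := ((hv.partialDeriv b).apply a).isContDiff (by simp)
  have hB : Torus.IsContDiff 1 (fun y => Torus.partialDeriv a v y b) := ((hv.partialDeriv a).apply b).isContDiff (by simp)
  have hfun : (fun y => (Torus.partialDeriv b v y a + Torus.partialDeriv a v y b) / 2) =
      (2⁻¹ : ℝ) • ((fun y => Torus.partialDeriv b v y a) + fun y => Torus.partialDeriv a v y b) := by
    funext y; simp [div_eq_inv_mul]
  rw [hfun, Torus.partialDeriv_const_smul (hA.add hB), Pi.smul_apply, Torus.partialDeriv_add hA hB,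
    Pi.add_apply, Torus.partialDeriv_apply_coord ((hv.partialDeriv b).isContDiff (by simp)),
    Torus.partialDeriv_apply_coord ((hv.partialDeriv a).isContDiff (by simp)), smul_eq_mul]
  ring

omit [DecidableEq d] in
/-- Pairing a symmetric array against a symmetrised one: `∑_{ab} Z_{ab} ½(G_{ba} + G_{ab}) = ∑_{ab} Z_{ab} G_{ab}`
for `Z` symmetric. [folklore] -/
private theorem sum_mul_symm_of_symm (Z G : d → d → ℝ) (hZ : ∀ a b, Z b a = Z a b) :
    ∑ a, ∑ b, Z a b * ((G b a + G a b) / 2) = ∑ a, ∑ b, Z a b * G a b := by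
  have h1 : ∑ a, ∑ b, Z a b * G b a = ∑ a, ∑ b, Z a b * G a b := by
    rw [Finset.sum_comm]
    exact Finset.sum_congr rfl fun a _ => Finset.sum_congr rfl fun b _ => by rw [hZ b a]
  have h2 : ∑ a, ∑ b, Z a b * ((G b a + G a b) / 2) =
      2⁻¹ * (∑ a, ∑ b, Z a b * G b a) + 2⁻¹ * (∑ a, ∑ b, Z a b * G a b) := by
    simp only [Finset.mul_sum, ← Finset.sum_add_distrib]
    exact Finset.sum_congr rfl fun a _ => Finset.sum_congr rfl fun b _ => by ring
  rw [h2, h1]; ring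

/-! ### Static identities -/

/-- **`div S = ½Δw` for a smooth divergence-free `w`** (`S = ∇_{sym}w`): pointwise
`∑ₐ ∂ₐ S_{ab} = ½ (Δw)_b` (Miller, ARMA 235 (2020), Prop 2.3: "`−2div(∇_{sym}u) = −Δu − ∇(∇·u) = −Δu`").
[cite: Miller2019, Prop 2.3 (proof)] -/
theorem sum_partialDeriv_strain_eq_half_laplacian {w : UnitAddTorus d → EuclideanSpace ℝ d}
    (hw : Torus.IsSmooth w) (hdiv : Torus.IsDivFree w) (b : d) (x : UnitAddTorus d) :
    ∑ a, Torus.partialDeriv a (fun y => (Torus.partialDeriv b w y a + Torus.partialDeriv a w y b) / 2) x =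
      2⁻¹ * Torus.laplacian w x b := by
  have hD1 : ∀ m, Torus.IsContDiff 1 (Torus.partialDeriv m w) := fun m => (hw.partialDeriv m).isContDiff (by simp)
  simp_rw [partialDeriv_strain hw]
  have e : ∀ a, (Torus.partialDeriv a (Torus.partialDeriv b w) x a + Torus.partialDeriv a (Torus.partialDeriv a w) x b) / 2 =
      2⁻¹ * Torus.partialDeriv a (fun y => Torus.partialDeriv b w y a) x +
        2⁻¹ * Torus.partialDeriv a (fun y => Torus.partialDeriv a w y b) x := by
    intro a
    rw [Torus.partialDeriv_apply_coord (hD1 b), Torus.partialDeriv_apply_coord (hD1 a)]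
    ring
  simp_rw [e]
  rw [Finset.sum_add_distrib, ← Finset.mul_sum, ← Finset.mul_sum,
    sum_partialDeriv_partialDeriv_apply_eq_zero' hw hdiv b x, mul_zero, zero_add, ← laplacian_apply_eq_sum' hw b x]

/-- **The symmetric gradient of the inertial term** (pointwise, every dimension): for a smooth field `v`,
`(∇_{sym}((v·∇)v))_{ab} = ∑_c v_c ∂_c S_{ab} + ∑_c S_{ac}S_{cb} + ¼∑_c W_{ac}W_{cb}`, i.e.
`∇_{sym}((u·∇)u) = (u·∇)S + S² + ¼(ω⊗ω − |ω|²I)` — the algebra behind Miller's strain equation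
(Pure Appl. Anal. 8 (2026), (1.4): "`∂ₜS − ΔS + (u·∇)S + S² + ¼ω⊗ω − ¼|ω|²I₃ + Hess(p) = 0`"; on `T³`,
`W² = ω⊗ω − |ω|²I`). [cite: Miller2026StrainVorticity, eq. (1.4)] -/
theorem symGrad_convect_apply {v : UnitAddTorus d → EuclideanSpace ℝ d} (hv : Torus.IsSmooth v) (a b : d)
    (x : UnitAddTorus d) :
    (Torus.partialDeriv a (Torus.convect v v) x b + Torus.partialDeriv b (Torus.convect v v) x a) / 2 =
      (∑ c, v x c * Torus.partialDeriv c
          (fun y => (Torus.partialDeriv b v y a + Torus.partialDeriv a v y b) / 2) x) +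
        (∑ c, ((Torus.partialDeriv c v x a + Torus.partialDeriv a v x c) / 2) *
          ((Torus.partialDeriv b v x c + Torus.partialDeriv c v x b) / 2)) +
        4⁻¹ * ∑ c, torusVorticityTensor v a c x * torusVorticityTensor v c b x := by
  have hv1 : Torus.IsContDiff 1 v := hv.isContDiff (by simp)
  have hD1 : ∀ m, Torus.IsContDiff 1 (Torus.partialDeriv m v) := fun m => (hv.partialDeriv m).isContDiff (by simp)
  -- Leibniz: `(∂ₘ((v·∇)v))_j = ∑_c v_c (∂_c∂ₘv)_j + ∑_c (∂ₘv)_c (∂_c v)_j`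
  have hL : ∀ m j, Torus.partialDeriv m (Torus.convect v v) x j =
      (∑ c, v x c * Torus.partialDeriv c (Torus.partialDeriv m v) x j) +
        ∑ c, Torus.partialDeriv m v x c * Torus.partialDeriv c v x j := by
    intro m j
    rw [Torus.partialDeriv_convect_eq_add_convect hv hv m x, PiLp.add_apply,
      Torus.convect_eq_sum_smul_partialDeriv (hD1 m) x, Torus.convect_eq_sum_smul_partialDeriv hv1 x]
    simp only [WithLp.ofLp_sum, WithLp.ofLp_smul, Finset.sum_apply, Pi.smul_apply, smul_eq_mul]
  rw [hL a b, hL b a]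
  simp_rw [partialDeriv_strain hv]
  simp only [torusVorticityTensor, Finset.mul_sum, ← Finset.sum_add_distrib, add_div, Finset.sum_div]
  refine Finset.sum_congr rfl fun c _ => ?_
  ring

/-- **`⟨ΔS, ∇_{sym}F⟩ = −½⟨Δ²v, F⟩`** on `T^d`: for a smooth divergence-free `v` and a smooth field `F`,
`∫ ∑_{ab} (ΔS)_{ab} ½((∂_a F)_b + (∂_b F)_a) = −½ ∫⟪Δ(Δv), F⟫`, `(ΔS)_{ab} = ½((∂_aΔv)_b + (∂_bΔv)_a)`
(by parts and `div(ΔS) = ½Δ²v`; the adjoint of Miller's `S = ∇_{sym}u ↔ u = −2div(−Δ)⁻¹S`,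
ARMA 235 (2020), (2.7)/Prop 2.3). [cite: Miller2019, Prop 2.3 (proof) and display (2.7)] -/
theorem integral_sum_laplacianStrain_mul_symGrad_eq {v F : UnitAddTorus d → EuclideanSpace ℝ d}
    (hv : Torus.IsSmooth v) (hdiv : Torus.IsDivFree v) (hF : Torus.IsSmooth F) :
    ∫ x, ∑ a, ∑ b, ((Torus.partialDeriv a (Torus.laplacian v) x b +
        Torus.partialDeriv b (Torus.laplacian v) x a) / 2) *
        ((Torus.partialDeriv a F x b + Torus.partialDeriv b F x a) / 2) =
      -(2⁻¹ * ∫ x, ⟪Torus.laplacian (Torus.laplacian v) x, F x⟫_ℝ) := by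
  set w := Torus.laplacian v with hw_def
  have hw : Torus.IsSmooth w := hv.laplacian
  have hdivw : Torus.IsDivFree w := Torus.IsDivFree.laplacian_of_isSmooth hv hdiv
  have hF1 : Torus.IsContDiff 1 F := hF.isContDiff (by simp)
  have hFc : ∀ b, Torus.IsSmooth (fun y => F y b) := fun b => hF.apply b
  have hSw : ∀ a b, Torus.IsSmooth (fun y => (Torus.partialDeriv b w y a + Torus.partialDeriv a w y b) / 2) :=
    isSmooth_strain hw
  have hDF : ∀ a b, Torus.IsSmooth (fun y => Torus.partialDeriv a F y b) := fun a b => (hF.partialDeriv a).apply b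
  -- pointwise: symmetry of `ΔS` removes the symmetrisation of `∇F`, and reindex to the house order
  have hpt : ∀ x, ∑ a, ∑ b, ((Torus.partialDeriv a w x b + Torus.partialDeriv b w x a) / 2) *
      ((Torus.partialDeriv a F x b + Torus.partialDeriv b F x a) / 2) =
      ∑ a, ∑ b, ((Torus.partialDeriv b w x a + Torus.partialDeriv a w x b) / 2) * Torus.partialDeriv a F x b := by
    intro x
    have h1 := sum_mul_symm_of_symm (fun a b => (Torus.partialDeriv b w x a + Torus.partialDeriv a w x b) / 2)
      (fun a b => Torus.partialDeriv a F x b) (fun a b => by ring)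
    rw [← h1]
    exact Finset.sum_congr rfl fun a _ => Finset.sum_congr rfl fun b _ => by ring
  simp_rw [hpt]
  -- integrate by parts entrywise
  rw [integral_finsetSum _ fun a _ => (isSmooth_sum' _ fun b _ => smooth_mul' (hSw a b) (hDF a b)).integrable]
  have h2 : ∀ a, ∫ x, ∑ b, ((Torus.partialDeriv b w x a + Torus.partialDeriv a w x b) / 2) * Torus.partialDeriv a F x b =
      ∑ b, -∫ x, Torus.partialDeriv a (fun y => (Torus.partialDeriv b w y a + Torus.partialDeriv a w y b) / 2) x * F x b := by
    intro a
    rw [integral_finsetSum _ fun b _ => (smooth_mul' (hSw a b) (hDF a b)).integrable]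
    refine Finset.sum_congr rfl fun b _ => ?_
    have e : ∀ x, ((Torus.partialDeriv b w x a + Torus.partialDeriv a w x b) / 2) * Torus.partialDeriv a F x b =
        ((Torus.partialDeriv b w x a + Torus.partialDeriv a w x b) / 2) * Torus.partialDeriv a (fun y => F y b) x := by
      intro x; rw [Torus.partialDeriv_apply_coord hF1]
    simp_rw [e]
    rw [integral_partialDeriv_mul_eq_neg' (hSw a b) (hFc b) a, neg_neg]
  simp_rw [h2]
  rw [Finset.sum_comm]
  simp only [Finset.sum_neg_distrib]
  congr 1
  -- `∑_a ∫ ∂_a S_{ab} F_b = ∫ ½(Δw)_b F_b`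
  have h3 : ∀ b, ∑ a, ∫ x, Torus.partialDeriv a
      (fun y => (Torus.partialDeriv b w y a + Torus.partialDeriv a w y b) / 2) x * F x b =
      ∫ x, 2⁻¹ * (Torus.laplacian w x b * F x b) := by
    intro b
    rw [← integral_finsetSum _ fun a _ => (smooth_mul' ((hSw a b).partialDeriv a) (hFc b)).integrable]
    refine integral_congr_ae (Filter.Eventually.of_forall fun x => ?_)
    show ∑ a, Torus.partialDeriv a (fun y => (Torus.partialDeriv b w y a + Torus.partialDeriv a w y b) / 2) x * F x b =
      2⁻¹ * (Torus.laplacian w x b * F x b)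
    rw [← Finset.sum_mul, sum_partialDeriv_strain_eq_half_laplacian hw hdivw b x]
    ring
  simp_rw [h3]
  rw [← integral_finsetSum _ fun b _ => (smooth_mul' (hw.laplacian.apply b) (hFc b)).integrable.const_mul _,
    ← MeasureTheory.integral_const_mul]
  refine integral_congr_ae (Filter.Eventually.of_forall fun x => ?_)
  show ∑ b, 2⁻¹ * (Torus.laplacian w x b * F x b) = 2⁻¹ * ⟪Torus.laplacian w x, F x⟫_ℝ
  rw [← Finset.mul_sum]
  congr 1
  simp [PiLp.inner_apply, mul_comm]

/-! ### Miller's `Ḣ¹`-strain flux identity: `−⟨Δ²u, (u·∇)u⟩ = 2⟨ΔS, P_{st}((u·∇)S + S² + ¾ω⊗ω)⟩` -/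

/-- **`∫⟪(v·∇)v, Δ²v⟫ = −2 ∫ ∑_{ab}(ΔS)_{ab} M_{ab}`** on `T³` for a smooth divergence-free `v`
(`card d = 3`, any frame `e`), `M = (v·∇)S + S² + ¾ω⊗ω` (`Torus.strainPerturbation`),
`(ΔS)_{ab} = ½((∂_aΔv)_b + (∂_bΔv)_a)`: the inertial term of the `Ḣ²` balance
`½ d/dt‖Δu‖² = −ν‖∇Δu‖² − ∫⟪(u·∇)u, Δ²u⟫` IS Miller's `−2⟨−ΔS, (u·∇)S + S² + ¾ω⊗ω⟩`. Transcription
of the proof of Thm 5.3 (Pure Appl. Anal. 8 (2026), (5.9)–(5.10)): `⟨−ΔS, ∂ₜS − ΔS⟩` against the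
strain equation (1.4), where `⟨ΔS, Hess p⟩ = 0`, `⟨ΔS, |ω|²I⟩ = 0` (`tr ΔS = 0`) and
`⟨−ΔS, ω⊗ω⟩ = 0` (Thm 1.3, tree `TorusStrainVorticityOrthogonality`) — here assembled from
`⟨ΔS, ∇_{sym}((v·∇)v)⟩ = −½⟨Δ²v, (v·∇)v⟩`, `∇_{sym}((v·∇)v) = (v·∇)S + S² + ¼W²`, `⟨ΔS, W²⟩ = 0`
and `∫ωᵀ(ΔS)ω = 0`. [cite: Miller2026StrainVorticity, Thm 5.3 (proof, (5.9)–(5.10)) with Thm 1.3] -/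
theorem integral_inner_convect_bilaplacian_eq (e : d ≃ Fin 3) {v : UnitAddTorus d → EuclideanSpace ℝ d}
    (hv : Torus.IsSmooth v) (hdiv : Torus.IsDivFree v) :
    ∫ x, ⟪Torus.convect v v x, Torus.laplacian (Torus.laplacian v) x⟫_ℝ =
      -2 * ∫ x, ∑ a, ∑ b, ((Torus.partialDeriv a (Torus.laplacian v) x b +
        Torus.partialDeriv b (Torus.laplacian v) x a) / 2) * Torus.strainPerturbation e v a b x := by
  set w := Torus.laplacian v with hw_def
  have hw : Torus.IsSmooth w := hv.laplacian
  have hF : Torus.IsSmooth (Torus.convect v v) := hv.convect hv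
  have hvc : ∀ c, Torus.IsSmooth (fun y => v y c) := fun c => hv.apply c
  have hS := isSmooth_strain hv
  have hLS : ∀ a b, Torus.IsSmooth (fun x => (Torus.partialDeriv a w x b + Torus.partialDeriv b w x a) / 2) :=
    fun a b => (((hw.partialDeriv a).apply b).add ((hw.partialDeriv b).apply a)).div_const 2
  have hW : ∀ i j, Torus.IsSmooth (torusVorticityTensor v i j) := isSmooth_W hv
  -- the three pieces of `M` and the `W²` field, as smooth functions
  set T : d → d → UnitAddTorus d → ℝ := fun a b x =>
    (∑ c, v x c * Torus.partialDeriv c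
        (fun y => (Torus.partialDeriv b v y a + Torus.partialDeriv a v y b) / 2) x) +
      ∑ c, ((Torus.partialDeriv c v x a + Torus.partialDeriv a v x c) / 2) *
        ((Torus.partialDeriv b v x c + Torus.partialDeriv c v x b) / 2) with hT
  have hTs : ∀ a b, Torus.IsSmooth (T a b) := fun a b =>
    (isSmooth_sum' _ fun c _ => smooth_mul' (hvc c) ((hS a b).partialDeriv c)).add
      (isSmooth_sum' _ fun c _ => smooth_mul' (hS a c) (hS c b))
  set W2 : d → d → UnitAddTorus d → ℝ := fun a b x =>
    ∑ c, torusVorticityTensor v a c x * torusVorticityTensor v c b x with hW2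
  have hW2s : ∀ a b, Torus.IsSmooth (W2 a b) := fun a b =>
    isSmooth_sum' _ fun c _ => smooth_mul' (hW a c) (hW c b)
  set Om : d → d → UnitAddTorus d → ℝ := fun a b x =>
    torusVorticityTensor v (e.symm (e a + 1)) (e.symm (e a + 2)) x *
      torusVorticityTensor v (e.symm (e b + 1)) (e.symm (e b + 2)) x with hOm
  have hOms : ∀ a b, Torus.IsSmooth (Om a b) := fun a b => smooth_mul' (hW _ _) (hW _ _)
  have hsumLS : ∀ {g : d → d → UnitAddTorus d → ℝ}, (∀ a b, Torus.IsSmooth (g a b)) →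
      Integrable (fun x => ∑ a, ∑ b, ((Torus.partialDeriv a w x b + Torus.partialDeriv b w x a) / 2) * g a b x) volume :=
    fun hg => (isSmooth_sum' _ fun a _ => isSmooth_sum' _ fun b _ => smooth_mul' (hLS a b) (hg a b)).integrable
  -- (1) `⟨ΔS, ∇_{sym}F⟩ = ⟨ΔS, T⟩ + ¼⟨ΔS, W²⟩ = ⟨ΔS, T⟩`
  have h1 : ∫ x, ∑ a, ∑ b, ((Torus.partialDeriv a w x b + Torus.partialDeriv b w x a) / 2) *
      ((Torus.partialDeriv a (Torus.convect v v) x b + Torus.partialDeriv b (Torus.convect v v) x a) / 2) =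
      ∫ x, ∑ a, ∑ b, ((Torus.partialDeriv a w x b + Torus.partialDeriv b w x a) / 2) * T a b x := by
    have hpt : ∀ x, ∑ a, ∑ b, ((Torus.partialDeriv a w x b + Torus.partialDeriv b w x a) / 2) *
        ((Torus.partialDeriv a (Torus.convect v v) x b + Torus.partialDeriv b (Torus.convect v v) x a) / 2) =
        (∑ a, ∑ b, ((Torus.partialDeriv a w x b + Torus.partialDeriv b w x a) / 2) * T a b x) +
          4⁻¹ * ∑ a, ∑ b, ((Torus.partialDeriv a w x b + Torus.partialDeriv b w x a) / 2) * W2 a b x := by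
      intro x
      simp_rw [symGrad_convect_apply hv]
      simp only [hT, hW2, Finset.mul_sum, ← Finset.sum_add_distrib]
      exact Finset.sum_congr rfl fun a _ => Finset.sum_congr rfl fun b _ => by ring
    simp_rw [hpt]
    rw [integral_add (hsumLS hTs) ((hsumLS hW2s).const_mul _), MeasureTheory.integral_const_mul]
    have h0 : ∫ x, ∑ a, ∑ b, ((Torus.partialDeriv a w x b + Torus.partialDeriv b w x a) / 2) * W2 a b x = 0 :=
      integral_sum_laplacian_strain_mul_vorticityTensor_sq_eq_zero hv hdiv
    rw [h0, mul_zero, add_zero]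
  -- (2) `⟨ΔS, M⟩ = ⟨ΔS, T⟩ + ¾∫ωᵀ(ΔS)ω = ⟨ΔS, T⟩`
  have h2 : ∫ x, ∑ a, ∑ b, ((Torus.partialDeriv a w x b + Torus.partialDeriv b w x a) / 2) *
      Torus.strainPerturbation e v a b x =
      ∫ x, ∑ a, ∑ b, ((Torus.partialDeriv a w x b + Torus.partialDeriv b w x a) / 2) * T a b x := by
    have hpt : ∀ x, ∑ a, ∑ b, ((Torus.partialDeriv a w x b + Torus.partialDeriv b w x a) / 2) *
        Torus.strainPerturbation e v a b x =
        (∑ a, ∑ b, ((Torus.partialDeriv a w x b + Torus.partialDeriv b w x a) / 2) * T a b x) +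
          3 / 4 * ∑ a, ∑ b, torusVorticityTensor v (e.symm (e a + 1)) (e.symm (e a + 2)) x *
            ((Torus.partialDeriv a w x b + Torus.partialDeriv b w x a) / 2) *
            torusVorticityTensor v (e.symm (e b + 1)) (e.symm (e b + 2)) x := by
      intro x
      have hM : ∀ a b, Torus.strainPerturbation e v a b x =
          T a b x + 3 / 4 * (torusVorticityTensor v (e.symm (e a + 1)) (e.symm (e a + 2)) x *
            torusVorticityTensor v (e.symm (e b + 1)) (e.symm (e b + 2)) x) := fun a b => rfl
      simp only [hM, Finset.mul_sum, ← Finset.sum_add_distrib]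
      exact Finset.sum_congr rfl fun a _ => Finset.sum_congr rfl fun b _ => by ring
    simp_rw [hpt]
    have hi2 : Integrable (fun x => 3 / 4 * ∑ a, ∑ b, torusVorticityTensor v (e.symm (e a + 1)) (e.symm (e a + 2)) x *
        ((Torus.partialDeriv a w x b + Torus.partialDeriv b w x a) / 2) *
        torusVorticityTensor v (e.symm (e b + 1)) (e.symm (e b + 2)) x) volume :=
      (isSmooth_sum' _ fun a _ => isSmooth_sum' _ fun b _ =>
        smooth_mul' (smooth_mul' (hW _ _) (hLS a b)) (hW _ _)).integrable.const_mul _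
    rw [integral_add (hsumLS hTs) hi2, MeasureTheory.integral_const_mul,
      integral_sum_vorticity_laplacianStrain_vorticity_eq_zero e hv hdiv, mul_zero, add_zero]
  -- (3) assemble with `⟨ΔS, ∇_{sym}F⟩ = −½⟨Δ²v, F⟩`
  have h3 := integral_sum_laplacianStrain_mul_symGrad_eq hv hdiv hF
  rw [h2, ← h1, h3]
  have hcomm : ∫ x, ⟪Torus.convect v v x, Torus.laplacian w x⟫_ℝ = ∫ x, ⟪Torus.laplacian w x, Torus.convect v v x⟫_ℝ :=
    integral_congr_ae (Filter.Eventually.of_forall fun x => real_inner_comm _ _)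
  rw [hcomm]
  ring

/-- **The projection may be inserted**: for a smooth divergence-free `v` on `T^d` (`d` nonempty) and
ANY smooth matrix field `M`, `∫ ∑_{ab}(ΔS)_{ab}(P_{st}M)_{ab} = ∫ ∑_{ab}(ΔS)_{ab}M_{ab}` — because
`ΔS = ∇_{sym}(Δv)` is itself a strain of a divergence-free field and `M − P_{st}M ⊥ L²_{st}`
(`Torus.integral_sum_strainProjection_mul_symGrad_eq`); this is the step "`S ∈ L²_{st}` lets us drop
the projection `P_{st}`" of Miller's energy computations (Anal. PDE 16 (2023), proof of Prop 1.5: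
"we have used the fact that `S ∈ L²_{st}` to drop the projection `P_{st}`").
[cite: Miller2023StrainModel, proof of Prop 1.5/Thm 3.x (dropping `P_{st}` against `S ∈ L²_{st}`); Miller2026StrainVorticity, Thm 5.3 (proof)] -/
theorem integral_sum_laplacianStrain_mul_strainProjection_eq [Nonempty d]
    {v : UnitAddTorus d → EuclideanSpace ℝ d} (hv : Torus.IsSmooth v) (hdiv : Torus.IsDivFree v)
    {M : d → d → UnitAddTorus d → ℝ} (hM : ∀ a b, Torus.IsSmooth (M a b)) :
    ∫ x, ∑ a, ∑ b, ((Torus.partialDeriv a (Torus.laplacian v) x b +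
        Torus.partialDeriv b (Torus.laplacian v) x a) / 2) * Torus.strainProjection M a b x =
      ∫ x, ∑ a, ∑ b, ((Torus.partialDeriv a (Torus.laplacian v) x b +
        Torus.partialDeriv b (Torus.laplacian v) x a) / 2) * M a b x := by
  have h := Torus.integral_sum_strainProjection_mul_symGrad_eq hM hv.laplacian
    (Torus.IsDivFree.laplacian_of_isSmooth hv hdiv)
  have e1 : ∀ x, ∑ a, ∑ b, ((Torus.partialDeriv a (Torus.laplacian v) x b +
      Torus.partialDeriv b (Torus.laplacian v) x a) / 2) * Torus.strainProjection M a b x =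
      ∑ a, ∑ b, Torus.strainProjection M a b x *
        ((Torus.partialDeriv b (Torus.laplacian v) x a + Torus.partialDeriv a (Torus.laplacian v) x b) / 2) :=
    fun x => Finset.sum_congr rfl fun a _ => Finset.sum_congr rfl fun b _ => by ring
  have e2 : ∀ x, ∑ a, ∑ b, ((Torus.partialDeriv a (Torus.laplacian v) x b +
      Torus.partialDeriv b (Torus.laplacian v) x a) / 2) * M a b x =
      ∑ a, ∑ b, M a b x *
        ((Torus.partialDeriv b (Torus.laplacian v) x a + Torus.partialDeriv a (Torus.laplacian v) x b) / 2) :=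
    fun x => Finset.sum_congr rfl fun a _ => Finset.sum_congr rfl fun b _ => by ring
  simp_rw [e1, e2]
  exact h

/-! ### Elementary bounds -/

/-- `‖∇v‖₂² ≤ ½‖Δv‖₂² + ½‖v‖₂²` for a smooth field on `T^d` (`‖∇v‖² = −⟨Δv, v⟩` and
`|⟨a, b⟩| ≤ ½(‖a‖² + ‖b‖²)`). [folklore] -/
private theorem gradNormSq_le_half_add_half {v : UnitAddTorus d → EuclideanSpace ℝ d} (hv : Torus.IsSmooth v) :
    Torus.gradNormSq v ≤ 2⁻¹ * (∫ x, ‖Torus.laplacian v x‖ ^ 2) + 2⁻¹ * ∫ x, ‖v x‖ ^ 2 := by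
  have h1 : Torus.gradNormSq v = -∫ x, ⟪Torus.laplacian v x, v x⟫_ℝ := by
    rw [Torus.integral_inner_laplacian_self_eq_neg_gradNormSq hv, neg_neg]
  rw [h1, ← MeasureTheory.integral_neg, ← MeasureTheory.integral_const_mul, ← MeasureTheory.integral_const_mul,
    ← integral_add (hv.laplacian.norm_sq.integrable.const_mul _) (hv.norm_sq.integrable.const_mul _)]
  refine integral_mono (hv.laplacian.inner hv).integrable.neg
    ((hv.laplacian.norm_sq.integrable.const_mul _).add (hv.norm_sq.integrable.const_mul _)) fun x => ?_
  have h2 : |⟪Torus.laplacian v x, v x⟫_ℝ| ≤ ‖Torus.laplacian v x‖ * ‖v x‖ := abs_real_inner_le_norm _ _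
  have h3 : 2 * ‖Torus.laplacian v x‖ * ‖v x‖ ≤ ‖Torus.laplacian v x‖ ^ 2 + ‖v x‖ ^ 2 :=
    two_mul_le_add_sq _ _
  show -⟪Torus.laplacian v x, v x⟫_ℝ ≤ 2⁻¹ * ‖Torus.laplacian v x‖ ^ 2 + 2⁻¹ * ‖v x‖ ^ 2
  have h4 : -⟪Torus.laplacian v x, v x⟫_ℝ ≤ |⟪Torus.laplacian v x, v x⟫_ℝ| := neg_le_abs _
  linarith

omit [DecidableEq d] in
/-- `card d = 3` makes `d` nonempty. [folklore] -/
private theorem nonempty_of_card (hd : Fintype.card d = 3) : Nonempty d :=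
  Fintype.card_pos_iff.mp (by omega)

/-- The flux of Miller's `Ḣ¹`-strain balance, Young form: for a smooth divergence-free `v` on `T³`
and `ν > 0`, `−ν‖∇Δv‖₂² + 2⟨ΔS, Q⟩ ≤ (2ν)⁻¹‖Q‖²_{L²}`, `Q = P_{st}((v·∇)S + S² + ¾ω⊗ω)`
(Cauchy–Schwarz, `‖ΔS‖²_{L²} = ½‖∇Δv‖₂²`, and `2xy ≤ 2νx² + y²/(2ν)`; Miller, Pure Appl. Anal. 8
(2026), proof of Thm 5.3, case `α = 0`: "`−‖−ΔS‖² + ‖Q‖‖−ΔS‖ ≤ ¼‖Q‖²`" at `ν = 1`, here ×2).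
[cite: Miller2026StrainVorticity, Thm 5.3 (proof, case α = 0)] -/
theorem strainH1Flux_le_sq (e : d ≃ Fin 3) {ν : ℝ} (hν : 0 < ν)
    {v : UnitAddTorus d → EuclideanSpace ℝ d} (hv : Torus.IsSmooth v) (hdiv : Torus.IsDivFree v) :
    -ν * Torus.gradNormSq (Torus.laplacian v) +
        2 * ∫ x, ∑ a, ∑ b, ((Torus.partialDeriv a (Torus.laplacian v) x b +
          Torus.partialDeriv b (Torus.laplacian v) x a) / 2) *
          Torus.strainProjection (Torus.strainPerturbation e v) a b x ≤
      (2 * ν)⁻¹ * ∫ x, ∑ a, ∑ b, Torus.strainProjection (Torus.strainPerturbation e v) a b x ^ 2 := by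
  have hM := Torus.isSmooth_strainPerturbation e hv
  have hQ := Torus.isSmooth_strainProjection hM
  have hLS : ∀ a b, Torus.IsSmooth (fun x => (Torus.partialDeriv a (Torus.laplacian v) x b +
      Torus.partialDeriv b (Torus.laplacian v) x a) / 2) := fun a b =>
    (((hv.laplacian.partialDeriv a).apply b).add ((hv.laplacian.partialDeriv b).apply a)).div_const 2
  set q : ℝ := ∫ x, ∑ a, ∑ b, Torus.strainProjection (Torus.strainPerturbation e v) a b x ^ 2 with hq
  set H₃ : ℝ := Torus.gradNormSq (Torus.laplacian v) with hH₃
  have hcs := Torus.integral_sum_sum_mul_le_sqrt_mul_sqrt (fun a b => (hLS a b).continuous) (fun a b => (hQ a b).continuous)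
  rw [StrainAlmostEigen.integral_sum_laplacianStrain_sq_eq hv hdiv] at hcs
  have hq0 : 0 ≤ q := integral_nonneg fun x => Finset.sum_nonneg fun a _ => Finset.sum_nonneg fun b _ => sq_nonneg _
  have hH0 : 0 ≤ H₃ := Torus.gradNormSq_nonneg _
  set s : ℝ := Real.sqrt (2⁻¹ * H₃) with hs
  set r : ℝ := Real.sqrt q with hr
  have hs2 : s ^ 2 = 2⁻¹ * H₃ := Real.sq_sqrt (by positivity)
  have hr2 : r ^ 2 = q := Real.sq_sqrt hq0
  -- Young: `2 s r ≤ 2ν s² + r²/(2ν)`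
  have hyoung : 2 * (s * r) ≤ 2 * ν * s ^ 2 + (2 * ν)⁻¹ * r ^ 2 := by
    have hsq : 0 ≤ (Real.sqrt (2 * ν) * s - r / Real.sqrt (2 * ν)) ^ 2 := sq_nonneg _
    have h2ν : 0 < 2 * ν := by positivity
    have hsr : Real.sqrt (2 * ν) ^ 2 = 2 * ν := Real.sq_sqrt h2ν.le
    have hsr0 : 0 < Real.sqrt (2 * ν) := Real.sqrt_pos.2 h2ν
    have e : (Real.sqrt (2 * ν) * s - r / Real.sqrt (2 * ν)) ^ 2 =
        2 * ν * s ^ 2 - 2 * (s * r) + (2 * ν)⁻¹ * r ^ 2 := by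
      field_simp
      rw [hsr]
      ring
    linarith [hsq, e.le, e.ge]
  calc -ν * H₃ + 2 * ∫ x, ∑ a, ∑ b, ((Torus.partialDeriv a (Torus.laplacian v) x b +
          Torus.partialDeriv b (Torus.laplacian v) x a) / 2) *
          Torus.strainProjection (Torus.strainPerturbation e v) a b x
      ≤ -ν * H₃ + 2 * (s * r) := by linarith [hcs]
    _ ≤ -ν * H₃ + (2 * ν * s ^ 2 + (2 * ν)⁻¹ * r ^ 2) := by linarith [hyoung]
    _ = (2 * ν)⁻¹ * q := by rw [hs2, hr2]; ring

/-- The flux of Miller's `Ḣ¹`-strain balance is NONPOSITIVE as soon as `‖Q‖_{L²} ≤ ν‖ΔS‖_{L²}`: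
for a smooth divergence-free `v` on `T³`, if `(∫∑Q²)^{1/2} ≤ ν (∫∑(ΔS)²)^{1/2}` then
`−ν‖∇Δv‖₂² + 2⟨ΔS, Q⟩ ≤ 0` (Miller, Pure Appl. Anal. 8 (2026), proof of Thm 5.4:
"`d/dt ½‖S‖²_{Ḣ¹} ≤ −‖−ΔS‖²(1 − ‖Q‖/‖−ΔS‖) < 0`"). [cite: Miller2026StrainVorticity, Thm 5.4 (= Thm 1.9), proof] -/
theorem strainH1Flux_nonpos_of_le (e : d ≃ Fin 3) {ν : ℝ}
    {v : UnitAddTorus d → EuclideanSpace ℝ d} (hv : Torus.IsSmooth v) (hdiv : Torus.IsDivFree v)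
    (hle : Real.sqrt (∫ x, ∑ a, ∑ b, Torus.strainProjection (Torus.strainPerturbation e v) a b x ^ 2) ≤
      ν * Real.sqrt (∫ x, ∑ a, ∑ b, ((Torus.partialDeriv a (Torus.laplacian v) x b +
        Torus.partialDeriv b (Torus.laplacian v) x a) / 2) ^ 2)) :
    -ν * Torus.gradNormSq (Torus.laplacian v) +
        2 * ∫ x, ∑ a, ∑ b, ((Torus.partialDeriv a (Torus.laplacian v) x b +
          Torus.partialDeriv b (Torus.laplacian v) x a) / 2) *
          Torus.strainProjection (Torus.strainPerturbation e v) a b x ≤ 0 := by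
  have hM := Torus.isSmooth_strainPerturbation e hv
  have hQ := Torus.isSmooth_strainProjection hM
  have hLS : ∀ a b, Torus.IsSmooth (fun x => (Torus.partialDeriv a (Torus.laplacian v) x b +
      Torus.partialDeriv b (Torus.laplacian v) x a) / 2) := fun a b =>
    (((hv.laplacian.partialDeriv a).apply b).add ((hv.laplacian.partialDeriv b).apply a)).div_const 2
  have hcs := Torus.integral_sum_sum_mul_le_sqrt_mul_sqrt (fun a b => (hLS a b).continuous) (fun a b => (hQ a b).continuous)
  set S2 : ℝ := ∫ x, ∑ a, ∑ b, ((Torus.partialDeriv a (Torus.laplacian v) x b +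
        Torus.partialDeriv b (Torus.laplacian v) x a) / 2) ^ 2 with hS2
  have hS2eq : S2 = 2⁻¹ * Torus.gradNormSq (Torus.laplacian v) :=
    StrainAlmostEigen.integral_sum_laplacianStrain_sq_eq hv hdiv
  have hS20 : 0 ≤ S2 := integral_nonneg fun x => Finset.sum_nonneg fun a _ => Finset.sum_nonneg fun b _ => sq_nonneg _
  have hs0 : 0 ≤ Real.sqrt S2 := Real.sqrt_nonneg _
  -- `∫(ΔS)Q ≤ √S2 · √q ≤ √S2 · ν √S2 = ν S2 = ν H₃/2`
  have h1 : ∫ x, ∑ a, ∑ b, ((Torus.partialDeriv a (Torus.laplacian v) x b +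
      Torus.partialDeriv b (Torus.laplacian v) x a) / 2) *
      Torus.strainProjection (Torus.strainPerturbation e v) a b x ≤ ν * S2 := by
    calc _ ≤ Real.sqrt S2 * Real.sqrt (∫ x, ∑ a, ∑ b,
          Torus.strainProjection (Torus.strainPerturbation e v) a b x ^ 2) := hcs
      _ ≤ Real.sqrt S2 * (ν * Real.sqrt S2) := mul_le_mul_of_nonneg_left hle hs0
      _ = ν * S2 := by rw [← mul_assoc, mul_comm (Real.sqrt S2) ν, mul_assoc, Real.mul_self_sqrt hS20]
  rw [hS2eq] at h1
  linarith

/-! ### Miller's `Ḣ¹`-strain balance along classical solutions on `T³` -/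

/-- **Miller's `Ḣ¹`-strain balance (Pure Appl. Anal. 8 (2026), (5.10)): `d/dt ½‖S‖²_{Ḣ¹} = −ν‖ΔS‖² − ⟨−ΔS, Q⟩`,
`Q = P_{st}((u·∇)S + S² + ¾ω⊗ω)`**, along a classical solution of the unforced Navier–Stokes
equations on `[a, b] × T^d` (`card d = 3`, any frame `e`), in the ladder variable `‖S‖²_{Ḣ¹} = ½‖Δu‖₂²`
(torus isometry, Miller Prop 2.5; tree `StrainAlmostEigen.integral_sum_strain_mul_laplacianStrain_eq`):
`s ↦ ½‖Δu(s)‖₂²` has one-sided derivative `−ν‖∇Δu(t)‖₂² + 2∫∑_{ab}(ΔS)_{ab}Q_{ab}` within `[a, b]` at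
`t` (= `2(−ν‖ΔS‖² − ⟨−ΔS, Q⟩)` since `‖ΔS‖² = ½‖∇Δu‖²`). The tree's `Ḣ²` balance
(`….hasDerivWithinAt_half_integral_norm_sq_laplacian_iterate`, `n = 1`) plus
`integral_inner_convect_bilaplacian_eq` and `integral_sum_laplacianStrain_mul_strainProjection_eq`.
[cite: Miller2026StrainVorticity, Thm 5.3 (proof, display (5.10))] -/
theorem _root_.Literature.Analysis.FunctionSpaces.Torus.IsClassicalNSSolutionOn.hasDerivWithinAt_half_laplacianSq_strainProjection
    (hd : Fintype.card d = 3) (e : d ≃ Fin 3) {a b ν : ℝ}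
    {u : ℝ → UnitAddTorus d → EuclideanSpace ℝ d} {p : ℝ → UnitAddTorus d → ℝ}
    (h : Torus.IsClassicalNSSolutionOn (Icc a b) ν 0 u p) (hab : a < b) {t : ℝ} (ht : t ∈ Icc a b) :
    HasDerivWithinAt (fun s => 2⁻¹ * ∫ x, ‖Torus.laplacian (u s) x‖ ^ 2)
      (-ν * Torus.gradNormSq (Torus.laplacian (u t)) +
        2 * ∫ x, ∑ i, ∑ j, ((Torus.partialDeriv i (Torus.laplacian (u t)) x j +
          Torus.partialDeriv j (Torus.laplacian (u t)) x i) / 2) *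
          Torus.strainProjection (Torus.strainPerturbation e (u t)) i j x) (Icc a b) t := by
  haveI := nonempty_of_card hd
  have hut : Torus.IsSmooth (u t) := h.smooth_velocity.isSmooth_slice ht
  have hdivt : Torus.IsDivFree (u t) := h.divFree t ht
  have hbal := h.hasDerivWithinAt_half_integral_norm_sq_laplacian_iterate hab 1 ht
  have e1 : (fun s => 2⁻¹ * ∫ x, ‖(Torus.laplacian^[1] (u s)) x‖ ^ 2) =
      fun s => 2⁻¹ * ∫ x, ‖Torus.laplacian (u s) x‖ ^ 2 := by
    funext s; rw [Function.iterate_one]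
  have e2 : Torus.laplacian^[2 * 1] (u t) = Torus.laplacian (Torus.laplacian (u t)) := by
    show Torus.laplacian^[2] (u t) = _
    rw [Function.iterate_succ_apply', Function.iterate_one]
  rw [e1, Function.iterate_one, e2] at hbal
  refine hbal.congr_deriv ?_
  have hconv : ∫ x, ⟪Torus.convect (u t) (u t) x - (0 : ℝ → UnitAddTorus d → EuclideanSpace ℝ d) t x,
      Torus.laplacian (Torus.laplacian (u t)) x⟫_ℝ =
      ∫ x, ⟪Torus.convect (u t) (u t) x, Torus.laplacian (Torus.laplacian (u t)) x⟫_ℝ := by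
    refine integral_congr_ae (Filter.Eventually.of_forall fun x => ?_)
    simp only [Pi.zero_apply, sub_zero]
  rw [hconv, integral_inner_convect_bilaplacian_eq e hut hdivt,
    ← integral_sum_laplacianStrain_mul_strainProjection_eq hut hdivt (Torus.isSmooth_strainPerturbation e hut)]
  ring

/-! ### The `Ḣ¹`–`Ḣ⁻¹` pairing for `α = 1`: `⟨ΔS, Q⟩ ≤ ‖S‖_{Ḣ¹}‖Q‖_{Ḣ¹}` -/

omit [DecidableEq d] in
/-- Cauchy–Schwarz for triple-indexed families of continuous functions:
`∫ ∑_{cab} A_{cab}B_{cab} ≤ (∫∑A²)^{1/2}(∫∑B²)^{1/2}`. [folklore] -/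
private theorem integral_sum₃_mul_le_sqrt_mul_sqrt {A B : d → d → d → UnitAddTorus d → ℝ}
    (hA : ∀ c a b, Continuous (A c a b)) (hB : ∀ c a b, Continuous (B c a b)) :
    ∫ x, ∑ c, ∑ a, ∑ b, A c a b x * B c a b x ≤
      Real.sqrt (∫ x, ∑ c, ∑ a, ∑ b, A c a b x ^ 2) * Real.sqrt (∫ x, ∑ c, ∑ a, ∑ b, B c a b x ^ 2) := by
  set P : ℝ := ∫ x, ∑ c, ∑ a, ∑ b, A c a b x * B c a b x with hP
  set X : ℝ := ∫ x, ∑ c, ∑ a, ∑ b, A c a b x ^ 2 with hX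
  set Y : ℝ := ∫ x, ∑ c, ∑ a, ∑ b, B c a b x ^ 2 with hY
  have hcA : Continuous fun x => ∑ c, ∑ a, ∑ b, A c a b x ^ 2 :=
    continuous_finsetSum _ fun c _ => continuous_finsetSum _ fun a _ => continuous_finsetSum _ fun b _ => (hA c a b).pow 2
  have hcB : Continuous fun x => ∑ c, ∑ a, ∑ b, B c a b x ^ 2 :=
    continuous_finsetSum _ fun c _ => continuous_finsetSum _ fun a _ => continuous_finsetSum _ fun b _ => (hB c a b).pow 2
  have hcP : Continuous fun x => ∑ c, ∑ a, ∑ b, A c a b x * B c a b x :=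
    continuous_finsetSum _ fun c _ => continuous_finsetSum _ fun a _ => continuous_finsetSum _ fun b _ =>
      (hA c a b).mul (hB c a b)
  have hX0 : 0 ≤ X := integral_nonneg fun x => Finset.sum_nonneg fun c _ =>
    Finset.sum_nonneg fun a _ => Finset.sum_nonneg fun b _ => sq_nonneg _
  have hquad : ∀ t : ℝ, 0 ≤ Y * (t * t) + (-2 * P) * t + X := by
    intro t
    have hpt : ∀ x, ∑ c, ∑ a, ∑ b, (t * B c a b x - A c a b x) ^ 2 =
        t ^ 2 * (∑ c, ∑ a, ∑ b, B c a b x ^ 2) + (-2 * t) * (∑ c, ∑ a, ∑ b, A c a b x * B c a b x) +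
          ∑ c, ∑ a, ∑ b, A c a b x ^ 2 := by
      intro x
      simp only [Finset.mul_sum, ← Finset.sum_add_distrib]
      exact Finset.sum_congr rfl fun c _ => Finset.sum_congr rfl fun a _ =>
        Finset.sum_congr rfl fun b _ => by ring
    have h0 : 0 ≤ ∫ x, ∑ c, ∑ a, ∑ b, (t * B c a b x - A c a b x) ^ 2 :=
      integral_nonneg fun x => Finset.sum_nonneg fun c _ => Finset.sum_nonneg fun a _ =>
        Finset.sum_nonneg fun b _ => sq_nonneg _
    simp_rw [hpt] at h0
    have i1 : Integrable (fun x => t ^ 2 * ∑ c, ∑ a, ∑ b, B c a b x ^ 2) volume :=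
      hcB.integrable_unitAddTorus.const_mul _
    have i2 : Integrable (fun x => (-2 * t) * ∑ c, ∑ a, ∑ b, A c a b x * B c a b x) volume :=
      hcP.integrable_unitAddTorus.const_mul _
    have i12 : Integrable (fun x => t ^ 2 * (∑ c, ∑ a, ∑ b, B c a b x ^ 2) +
        (-2 * t) * ∑ c, ∑ a, ∑ b, A c a b x * B c a b x) volume := i1.add i2
    have i3 : Integrable (fun x => ∑ c, ∑ a, ∑ b, A c a b x ^ 2) volume := hcA.integrable_unitAddTorus
    rw [integral_add i12 i3, integral_add i1 i2, MeasureTheory.integral_const_mul,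
      MeasureTheory.integral_const_mul] at h0
    have e : Y * (t * t) + (-2 * P) * t + X = t ^ 2 * Y + (-2 * t) * P + X := by ring
    rw [e]; exact h0
  have hdisc := discrim_le_zero hquad
  rw [discrim] at hdisc
  have hPXY : P ^ 2 ≤ X * Y := by nlinarith [hdisc]
  calc P ≤ |P| := le_abs_self P
    _ = Real.sqrt (P ^ 2) := (Real.sqrt_sq_eq_abs P).symm
    _ ≤ Real.sqrt (X * Y) := Real.sqrt_le_sqrt hPXY
    _ = Real.sqrt X * Real.sqrt Y := Real.sqrt_mul hX0 Y

/-- `⟨ΔS, Q⟩ = −∑_c ⟨∂_c S, ∂_c Q⟩` for a smooth field `v` and a smooth matrix field `Q` on `T^d`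
(`(ΔS)_{ab} = Δ(S_{ab})`, tree `laplacian_strain_apply`, and Green's first identity). [folklore] -/
private theorem integral_sum_laplacianStrain_mul_eq_neg_sum {v : UnitAddTorus d → EuclideanSpace ℝ d}
    (hv : Torus.IsSmooth v) {Q : d → d → UnitAddTorus d → ℝ} (hQ : ∀ a b, Torus.IsSmooth (Q a b)) :
    ∫ x, ∑ a, ∑ b, ((Torus.partialDeriv a (Torus.laplacian v) x b +
        Torus.partialDeriv b (Torus.laplacian v) x a) / 2) * Q a b x =
      -∑ c, ∫ x, ∑ a, ∑ b, Torus.partialDeriv c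
        (fun y => (Torus.partialDeriv a v y b + Torus.partialDeriv b v y a) / 2) x *
          Torus.partialDeriv c (Q a b) x := by
  have hS : ∀ a b, Torus.IsSmooth (fun y => (Torus.partialDeriv a v y b + Torus.partialDeriv b v y a) / 2) :=
    fun a b => (((hv.partialDeriv a).apply b).add ((hv.partialDeriv b).apply a)).div_const 2
  have hLS : ∀ a b, Torus.IsSmooth (fun x => (Torus.partialDeriv a (Torus.laplacian v) x b +
      Torus.partialDeriv b (Torus.laplacian v) x a) / 2) := fun a b =>
    (((hv.laplacian.partialDeriv a).apply b).add ((hv.laplacian.partialDeriv b).apply a)).div_const 2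
  -- `(ΔS)_{ab} Q_{ab} = Q_{ab} Δ(S_{ab})`
  have hpt : ∀ x a b, ((Torus.partialDeriv a (Torus.laplacian v) x b +
      Torus.partialDeriv b (Torus.laplacian v) x a) / 2) * Q a b x =
      Q a b x * Torus.laplacian (fun y => (Torus.partialDeriv a v y b + Torus.partialDeriv b v y a) / 2) x := by
    intro x a b
    rw [laplacian_strain_apply hv a b x, mul_comm]
  simp_rw [hpt]
  rw [integral_finsetSum _ fun a _ => (isSmooth_sum' _ fun b _ => smooth_mul' (hQ a b) (hS a b).laplacian).integrable]
  have h1 : ∀ a, ∫ x, ∑ b, Q a b x * Torus.laplacian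
      (fun y => (Torus.partialDeriv a v y b + Torus.partialDeriv b v y a) / 2) x =
      ∑ b, -∑ c, ∫ x, Torus.partialDeriv c (Q a b) x * Torus.partialDeriv c
        (fun y => (Torus.partialDeriv a v y b + Torus.partialDeriv b v y a) / 2) x := by
    intro a
    rw [integral_finsetSum _ fun b _ => (smooth_mul' (hQ a b) (hS a b).laplacian).integrable]
    exact Finset.sum_congr rfl fun b _ => Torus.integral_mul_laplacian_eq_neg_sum (hQ a b) (hS a b)
  simp_rw [h1]
  simp only [Finset.sum_neg_distrib]
  rw [neg_inj]
  -- swap the sums: `∑_a ∑_b ∑_c ∫ … = ∑_c ∫ ∑_a ∑_b …`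
  have h2 : ∀ c, ∫ x, ∑ a, ∑ b, Torus.partialDeriv c
      (fun y => (Torus.partialDeriv a v y b + Torus.partialDeriv b v y a) / 2) x * Torus.partialDeriv c (Q a b) x =
      ∑ a, ∑ b, ∫ x, Torus.partialDeriv c (Q a b) x * Torus.partialDeriv c
        (fun y => (Torus.partialDeriv a v y b + Torus.partialDeriv b v y a) / 2) x := by
    intro c
    rw [integral_finsetSum _ fun a _ => (isSmooth_sum' _ fun b _ =>
      smooth_mul' ((hS a b).partialDeriv c) ((hQ a b).partialDeriv c)).integrable]
    refine Finset.sum_congr rfl fun a _ => ?_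
    rw [integral_finsetSum _ fun b _ => (smooth_mul' ((hS a b).partialDeriv c) ((hQ a b).partialDeriv c)).integrable]
    exact Finset.sum_congr rfl fun b _ => integral_congr_ae (Filter.Eventually.of_forall fun x => mul_comm _ _)
  simp_rw [h2]
  symm
  rw [Finset.sum_comm]
  exact Finset.sum_congr rfl fun a _ => Finset.sum_comm

/-- `‖∇S‖²_{L²} = ½‖Δv‖₂²` (`= ‖S‖²_{Ḣ¹}`) for a smooth divergence-free `v` on `T^d`:
`∑_c ∫ ∑_{ab} (∂_c S_{ab})² = ½∫‖Δv‖²` (Green and the tree's `⟨S, ΔS⟩ = −½‖Δv‖²`, Miller Prop 2.5).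
[cite: Miller2026StrainVorticity, Prop 2.5] -/
theorem sum_integral_sum_partialDeriv_strain_sq_eq {v : UnitAddTorus d → EuclideanSpace ℝ d}
    (hv : Torus.IsSmooth v) (hdiv : Torus.IsDivFree v) :
    ∑ c, ∫ x, ∑ a, ∑ b, Torus.partialDeriv c
        (fun y => (Torus.partialDeriv a v y b + Torus.partialDeriv b v y a) / 2) x ^ 2 =
      2⁻¹ * ∫ x, ‖Torus.laplacian v x‖ ^ 2 := by
  have hS : ∀ a b, Torus.IsSmooth (fun y => (Torus.partialDeriv a v y b + Torus.partialDeriv b v y a) / 2) :=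
    fun a b => (((hv.partialDeriv a).apply b).add ((hv.partialDeriv b).apply a)).div_const 2
  have h1 := integral_sum_laplacianStrain_mul_eq_neg_sum hv hS
  -- left side of `h1` is `⟨ΔS, S⟩ = −½‖Δv‖²` (tree, after reindexing)
  have h2 : ∫ x, ∑ a, ∑ b, ((Torus.partialDeriv a (Torus.laplacian v) x b +
      Torus.partialDeriv b (Torus.laplacian v) x a) / 2) *
      ((Torus.partialDeriv a v x b + Torus.partialDeriv b v x a) / 2) = -(2⁻¹ * ∫ x, ‖Torus.laplacian v x‖ ^ 2) := by
    rw [← StrainAlmostEigen.integral_sum_strain_mul_laplacianStrain_eq hv hdiv]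
    refine integral_congr_ae (Filter.Eventually.of_forall fun x => ?_)
    exact Finset.sum_congr rfl fun a _ => Finset.sum_congr rfl fun b _ => by ring
  rw [h2] at h1
  have h3 : ∑ c, ∫ x, ∑ a, ∑ b, Torus.partialDeriv c
      (fun y => (Torus.partialDeriv a v y b + Torus.partialDeriv b v y a) / 2) x ^ 2 =
      ∑ c, ∫ x, ∑ a, ∑ b, Torus.partialDeriv c
        (fun y => (Torus.partialDeriv a v y b + Torus.partialDeriv b v y a) / 2) x *
        Torus.partialDeriv c (fun y => (Torus.partialDeriv a v y b + Torus.partialDeriv b v y a) / 2) x :=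
    Finset.sum_congr rfl fun c _ => integral_congr_ae (Filter.Eventually.of_forall fun x =>
      Finset.sum_congr rfl fun a _ => Finset.sum_congr rfl fun b _ => by ring)
  rw [h3]
  linarith

/-- The flux of Miller's `Ḣ¹`-strain balance, `α = 1` form: for a smooth divergence-free `v` on `T³`
and `ν ≥ 0`, `−ν‖∇Δv‖₂² + 2⟨ΔS, Q⟩ ≤ 2 (½‖Δv‖₂²)^{1/2} ‖∇Q‖_{L²}`, `‖∇Q‖²_{L²} = ∑_c∫∑_{ab}(∂_cQ_{ab})²`
(duality `⟨−ΔS, Q⟩ ≤ ‖−ΔS‖_{Ḣ⁻¹}‖Q‖_{Ḣ¹} = ‖S‖_{Ḣ¹}‖Q‖_{Ḣ¹}`, Miller, Pure Appl. Anal. 8 (2026), proof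
of Thm 5.3, case `α = 1`). [cite: Miller2026StrainVorticity, Thm 5.3 (proof, case α = 1)] -/
theorem strainH1Flux_le_sqrt_mul_grad (e : d ≃ Fin 3) {ν : ℝ} (hν : 0 ≤ ν)
    {v : UnitAddTorus d → EuclideanSpace ℝ d} (hv : Torus.IsSmooth v) (hdiv : Torus.IsDivFree v) :
    -ν * Torus.gradNormSq (Torus.laplacian v) +
        2 * ∫ x, ∑ a, ∑ b, ((Torus.partialDeriv a (Torus.laplacian v) x b +
          Torus.partialDeriv b (Torus.laplacian v) x a) / 2) *
          Torus.strainProjection (Torus.strainPerturbation e v) a b x ≤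
      2 * (Real.sqrt (2⁻¹ * ∫ x, ‖Torus.laplacian v x‖ ^ 2) *
        Real.sqrt (∑ c, ∫ x, ∑ a, ∑ b,
          Torus.partialDeriv c (Torus.strainProjection (Torus.strainPerturbation e v) a b) x ^ 2)) := by
  have hM := Torus.isSmooth_strainPerturbation e hv
  have hQ := Torus.isSmooth_strainProjection hM
  have hS : ∀ a b, Torus.IsSmooth (fun y => (Torus.partialDeriv a v y b + Torus.partialDeriv b v y a) / 2) :=
    fun a b => (((hv.partialDeriv a).apply b).add ((hv.partialDeriv b).apply a)).div_const 2
  have hdiss : 0 ≤ ν * Torus.gradNormSq (Torus.laplacian v) := mul_nonneg hν (Torus.gradNormSq_nonneg _)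
  have h1 := integral_sum_laplacianStrain_mul_eq_neg_sum hv hQ
  -- Cauchy–Schwarz on the triple sum
  have hcs := integral_sum₃_mul_le_sqrt_mul_sqrt
    (A := fun c a b x => -Torus.partialDeriv c
      (fun y => (Torus.partialDeriv a v y b + Torus.partialDeriv b v y a) / 2) x)
    (B := fun c a b x => Torus.partialDeriv c (Torus.strainProjection (Torus.strainPerturbation e v) a b) x)
    (fun c a b => ((hS a b).partialDeriv c).continuous.neg) (fun c a b => ((hQ a b).partialDeriv c).continuous)
  have hneg : ∫ x, ∑ c, ∑ a, ∑ b, -Torus.partialDeriv c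
      (fun y => (Torus.partialDeriv a v y b + Torus.partialDeriv b v y a) / 2) x *
      Torus.partialDeriv c (Torus.strainProjection (Torus.strainPerturbation e v) a b) x =
      -∑ c, ∫ x, ∑ a, ∑ b, Torus.partialDeriv c
        (fun y => (Torus.partialDeriv a v y b + Torus.partialDeriv b v y a) / 2) x *
        Torus.partialDeriv c (Torus.strainProjection (Torus.strainPerturbation e v) a b) x := by
    have hpt : ∀ x, ∑ c, ∑ a, ∑ b, -Torus.partialDeriv c
        (fun y => (Torus.partialDeriv a v y b + Torus.partialDeriv b v y a) / 2) x *
        Torus.partialDeriv c (Torus.strainProjection (Torus.strainPerturbation e v) a b) x =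
        -(∑ c, ∑ a, ∑ b, Torus.partialDeriv c
          (fun y => (Torus.partialDeriv a v y b + Torus.partialDeriv b v y a) / 2) x *
          Torus.partialDeriv c (Torus.strainProjection (Torus.strainPerturbation e v) a b) x) := by
      intro x; simp only [neg_mul, Finset.sum_neg_distrib]
    simp_rw [hpt]
    rw [MeasureTheory.integral_neg, MeasureTheory.integral_finsetSum _ fun c _ =>
      (isSmooth_sum' _ fun a _ => isSmooth_sum' _ fun b _ =>
        smooth_mul' ((hS a b).partialDeriv c) ((hQ a b).partialDeriv c)).integrable]
  have hsq : ∫ x, ∑ c, ∑ a, ∑ b, (-Torus.partialDeriv c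
      (fun y => (Torus.partialDeriv a v y b + Torus.partialDeriv b v y a) / 2) x) ^ 2 =
      2⁻¹ * ∫ x, ‖Torus.laplacian v x‖ ^ 2 := by
    have hpt : ∀ x, ∑ c, ∑ a, ∑ b, (-Torus.partialDeriv c
        (fun y => (Torus.partialDeriv a v y b + Torus.partialDeriv b v y a) / 2) x) ^ 2 =
        ∑ c, ∑ a, ∑ b, Torus.partialDeriv c
          (fun y => (Torus.partialDeriv a v y b + Torus.partialDeriv b v y a) / 2) x ^ 2 := by
      intro x
      exact Finset.sum_congr rfl fun c _ => Finset.sum_congr rfl fun a _ =>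
        Finset.sum_congr rfl fun b _ => by ring
    simp_rw [hpt]
    rw [← sum_integral_sum_partialDeriv_strain_sq_eq hv hdiv, MeasureTheory.integral_finsetSum _ fun c _ =>
      (isSmooth_sum' _ fun a _ => isSmooth_sum' _ fun b _ => smooth_sq' ((hS a b).partialDeriv c)).integrable]
  have hsq2 : ∫ x, ∑ c, ∑ a, ∑ b, Torus.partialDeriv c
      (Torus.strainProjection (Torus.strainPerturbation e v) a b) x ^ 2 =
      ∑ c, ∫ x, ∑ a, ∑ b, Torus.partialDeriv c (Torus.strainProjection (Torus.strainPerturbation e v) a b) x ^ 2 :=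
    MeasureTheory.integral_finsetSum _ fun c _ => (isSmooth_sum' _ fun a _ => isSmooth_sum' _ fun b _ =>
      smooth_sq' ((hQ a b).partialDeriv c)).integrable
  rw [hneg, hsq, hsq2, ← h1] at hcs
  linarith

end StrainProjectionCriterion

open StrainProjectionCriterion

/-! ### Theorem 1.8 (`α = 0`): Grönwall and continuation forms -/

/-- **Miller's Theorem 1.8 at `α = 0` (`p = 2`), Grönwall form on `T³`** (Pure Appl. Anal. 8 (2026),
Thm 1.8 = Thm 5.3: "`‖S(·,t)‖²_{Ḣ¹} ≤ ‖S⁰‖²_{Ḣ¹} exp(C₀ ∫₀ᵗ ‖P_{st}((u·∇)S + S² + ¾ω⊗ω)‖²_{L²}/‖S‖²_{Ḣ¹} dτ)`"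
with the printed constant `C₀ = ½` at `ν = 1`; general `ν`: `C₀ = (2ν)⁻¹`). Along a classical solution
of the unforced Navier–Stokes equations with `ν > 0` on `[a, b] × T^d` (`card d = 3`, frame `e`,
`Q(s) = P_{st}((u·∇)S + S² + ¾ω⊗ω)(s)`), if `Λ` is continuous on `[a, b]` with
`‖Q(s)‖²_{L²} ≤ Λ(s) · ½‖Δu(s)‖₂²` for all `s ∈ [a, b]` (`½‖Δu‖₂² = ‖S‖²_{Ḣ¹}`; `Λ = ‖Q‖²/‖S‖²_{Ḣ¹}` is
the printed integrand), then `½‖Δu(t)‖₂² ≤ ½‖Δu(a)‖₂² · exp((2ν)⁻¹ ∫ₐᵗ Λ)` for every `t ∈ [a, b]`.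
[cite: Miller2026StrainVorticity, Thm 1.8 (= Thm 5.3), case α = 0 (C₀ = 1/2)] -/
theorem Torus.half_laplacianSq_le_mul_exp_integral_of_strainProjection_sq_le (hd : Fintype.card d = 3)
    (e : d ≃ Fin 3) {ν a b : ℝ} (hν : 0 < ν) (hab : a < b)
    {u : ℝ → UnitAddTorus d → EuclideanSpace ℝ d} {p : ℝ → UnitAddTorus d → ℝ}
    (h : Torus.IsClassicalNSSolutionOn (Icc a b) ν 0 u p)
    {Λ : ℝ → ℝ} (hΛc : ContinuousOn Λ (Icc a b))
    (hΛ : ∀ s ∈ Icc a b,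
      ∫ x, ∑ i, ∑ j, Torus.strainProjection (Torus.strainPerturbation e (u s)) i j x ^ 2 ≤
        Λ s * (2⁻¹ * ∫ x, ‖Torus.laplacian (u s) x‖ ^ 2))
    {t : ℝ} (ht : t ∈ Icc a b) :
    2⁻¹ * ∫ x, ‖Torus.laplacian (u t) x‖ ^ 2 ≤
      (2⁻¹ * ∫ x, ‖Torus.laplacian (u a) x‖ ^ 2) * Real.exp ((2 * ν)⁻¹ * ∫ s in a..t, Λ s) := by
  set G : ℝ → ℝ := fun s => -ν * Torus.gradNormSq (Torus.laplacian (u s)) +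
    2 * ∫ x, ∑ i, ∑ j, ((Torus.partialDeriv i (Torus.laplacian (u s)) x j +
      Torus.partialDeriv j (Torus.laplacian (u s)) x i) / 2) *
      Torus.strainProjection (Torus.strainPerturbation e (u s)) i j x with hG
  have hder : ∀ s ∈ Icc a b, HasDerivWithinAt (fun r => 2⁻¹ * ∫ x, ‖Torus.laplacian (u r) x‖ ^ 2)
      (G s) (Icc a b) s := fun s hs => h.hasDerivWithinAt_half_laplacianSq_strainProjection hd e hab hs
  have hle : ∀ s ∈ Icc a b, G s ≤ ((2 * ν)⁻¹ * Λ s) * (2⁻¹ * ∫ x, ‖Torus.laplacian (u s) x‖ ^ 2) := by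
    intro s hs
    have hus : Torus.IsSmooth (u s) := h.smooth_velocity.isSmooth_slice hs
    have h1 := strainH1Flux_le_sq e hν hus (h.divFree s hs)
    have h2 : (2 * ν)⁻¹ * ∫ x, ∑ i, ∑ j, Torus.strainProjection (Torus.strainPerturbation e (u s)) i j x ^ 2 ≤
        (2 * ν)⁻¹ * (Λ s * (2⁻¹ * ∫ x, ‖Torus.laplacian (u s) x‖ ^ 2)) :=
      mul_le_mul_of_nonneg_left (hΛ s hs) (by positivity)
    simp only [hG]
    linarith
  have hk : ContinuousOn (fun s => (2 * ν)⁻¹ * Λ s) (Icc a b) := continuousOn_const.mul hΛc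
  have hmain := le_mul_exp_integral_of_hasDerivWithinAt_le_mul hab hder hk hle ht
  rwa [intervalIntegral.integral_const_mul] at hmain

/-- Along a classical solution on `[0, T) × T^d` the quantity `½‖Δu(t)‖₂²` is continuous on `[0, T)`.
[folklore] -/
private theorem continuousOn_half_laplacianSq {ν T : ℝ} {f u : ℝ → UnitAddTorus d → EuclideanSpace ℝ d}
    {p : ℝ → UnitAddTorus d → ℝ} (h : Torus.IsClassicalNSSolutionOn (Ico 0 T) ν f u p) :
    ContinuousOn (fun t => 2⁻¹ * ∫ x, ‖Torus.laplacian (u t) x‖ ^ 2) (Ico 0 T) := by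
  have hL : Torus.IsSmoothSpaceTimeOn (Ico 0 T) (fun t => Torus.laplacian (u t)) :=
    h.smooth_velocity.laplacian (uniqueDiffOn_Ico 0 T)
  exact continuousOn_const.mul (hL.normSq.continuousOn_integral (convex_Ico 0 T))

/-- **Continuation from a bound on `½‖Δu‖₂²`**: a classical solution of the unforced Navier–Stokes
equations (`ν > 0`) on `[0, T) × T^d` (`card d = 3`) with mean-zero slices and `½‖Δu(t)‖₂² ≤ B` on
`[0, T)` continues past `T` (`‖∇u‖₂² ≤ ½‖Δu‖₂² + ½‖u‖₂² ≤ B + K(u₀)` by energy decay, then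
`Torus.classicalNS_continuation_of_gradNormSq_le`, RRS 2016 Lemma 6.11). [cite: RobinsonRodrigoSadowskiCUP2016, Lemma 6.11] -/
theorem Torus.classicalNS_continuation_of_half_laplacianSq_le (hd : Fintype.card d = 3) {ν T : ℝ}
    (hν : 0 < ν) (hT : 0 < T) {u : ℝ → UnitAddTorus d → EuclideanSpace ℝ d}
    {p : ℝ → UnitAddTorus d → ℝ} (h : Torus.IsClassicalNSSolutionOn (Ico 0 T) ν 0 u p)
    (hmean : ∀ t ∈ Ico 0 T, Torus.HasZeroMean (u t)) {B : ℝ}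
    (hB : ∀ t ∈ Ico 0 T, 2⁻¹ * ∫ x, ‖Torus.laplacian (u t) x‖ ^ 2 ≤ B) :
    ∃ T' : ℝ, T < T' ∧ ∃ (u' : ℝ → UnitAddTorus d → EuclideanSpace ℝ d)
      (p' : ℝ → UnitAddTorus d → ℝ), Torus.IsClassicalNSSolutionOn (Icc 0 T') ν 0 u' p' ∧
        (∀ t ∈ Icc 0 T', Torus.HasZeroMean (u' t)) ∧ ∀ t ∈ Ico 0 T, u' t = u t := by
  refine Torus.classicalNS_continuation_of_gradNormSq_le hd hν hT h hmean
    (E₁ := B + Torus.kineticEnergy (u 0)) fun t ht => ?_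
  have hut : Torus.IsSmooth (u t) := h.smooth_velocity.isSmooth_slice ht
  have h1 := gradNormSq_le_half_add_half hut
  have hK : Torus.kineticEnergy (u t) ≤ Torus.kineticEnergy (u 0) :=
    kineticEnergy_le_of_le hν.le h (convex_Ico 0 T) ht.1 (fun s hs => ⟨hs.1, hs.2.trans_lt ht.2⟩)
  have hKdef : Torus.kineticEnergy (u t) = 2⁻¹ * ∫ x, ‖u t x‖ ^ 2 := rfl
  linarith [hB t ht]

/-- **Miller's Theorem 1.8 at `α = 0`, continuation form on `T³`** ("in particular, if `T_max < +∞`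
then `∫₀^{T_max} ‖Q‖²_{L²}/‖S‖²_{Ḣ¹} dt = +∞`", Pure Appl. Anal. 8 (2026), (1.28) at `α = 0`): a classical
solution of the unforced Navier–Stokes equations (`ν > 0`) on `[0, T) × T^d` (`card d = 3`, `T > 0`,
mean-zero slices) for which some continuous `Λ` on `[0, T)` satisfies
`‖Q(t)‖²_{L²} ≤ Λ(t) · ½‖Δu(t)‖₂²` and `∫₀ᵗ Λ ≤ I` for all `t ∈ [0, T)` continues to a classical solution on
some `[0, T']`, `T' > T`. [cite: Miller2026StrainVorticity, Thm 1.8 (= Thm 5.3), case α = 0, display (1.28)] -/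
theorem Torus.classicalNS_continuation_of_strainProjection_sq_integral_le (hd : Fintype.card d = 3)
    (e : d ≃ Fin 3) {ν T : ℝ} (hν : 0 < ν) (hT : 0 < T)
    {u : ℝ → UnitAddTorus d → EuclideanSpace ℝ d} {p : ℝ → UnitAddTorus d → ℝ}
    (h : Torus.IsClassicalNSSolutionOn (Ico 0 T) ν 0 u p)
    (hmean : ∀ t ∈ Ico 0 T, Torus.HasZeroMean (u t)) {Λ : ℝ → ℝ}
    (hΛc : ContinuousOn Λ (Ico 0 T))
    (hΛ : ∀ t ∈ Ico 0 T,
      ∫ x, ∑ i, ∑ j, Torus.strainProjection (Torus.strainPerturbation e (u t)) i j x ^ 2 ≤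
        Λ t * (2⁻¹ * ∫ x, ‖Torus.laplacian (u t) x‖ ^ 2))
    {I : ℝ} (hI : ∀ t ∈ Ico 0 T, ∫ s in (0 : ℝ)..t, Λ s ≤ I) :
    ∃ T' : ℝ, T < T' ∧ ∃ (u' : ℝ → UnitAddTorus d → EuclideanSpace ℝ d)
      (p' : ℝ → UnitAddTorus d → ℝ), Torus.IsClassicalNSSolutionOn (Icc 0 T') ν 0 u' p' ∧
        (∀ t ∈ Icc 0 T', Torus.HasZeroMean (u' t)) ∧ ∀ t ∈ Ico 0 T, u' t = u t := by
  have hI0 : 0 ≤ I := by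
    have h0 := hI 0 ⟨le_rfl, hT⟩
    rwa [intervalIntegral.integral_same] at h0
  set F0 : ℝ := 2⁻¹ * ∫ x, ‖Torus.laplacian (u 0) x‖ ^ 2 with hF0
  have hF00 : 0 ≤ F0 := mul_nonneg (by norm_num) (integral_nonneg fun x => sq_nonneg _)
  refine Torus.classicalNS_continuation_of_half_laplacianSq_le hd hν hT h hmean
    (B := F0 * Real.exp ((2 * ν)⁻¹ * I)) fun t ht => ?_
  rcases ht.1.eq_or_lt with h0 | h0t
  · rw [← h0]
    exact le_mul_of_one_le_right hF00 (Real.one_le_exp (by positivity))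
  · have hsub : Icc 0 t ⊆ Ico 0 T := fun s hs => ⟨hs.1, hs.2.trans_lt ht.2⟩
    have ht' : Torus.IsClassicalNSSolutionOn (Icc 0 t) ν 0 u p := h.mono hsub (uniqueDiffOn_Icc h0t)
    have hmain := Torus.half_laplacianSq_le_mul_exp_integral_of_strainProjection_sq_le hd e hν h0t ht'
      (hΛc.mono hsub) (fun s hs => hΛ s (hsub hs)) ⟨h0t.le, le_rfl⟩
    have hexp : Real.exp ((2 * ν)⁻¹ * ∫ s in (0 : ℝ)..t, Λ s) ≤ Real.exp ((2 * ν)⁻¹ * I) :=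
      Real.exp_le_exp.2 (mul_le_mul_of_nonneg_left (hI t ht) (by positivity))
    exact hmain.trans (mul_le_mul_of_nonneg_left hexp hF00)

/-! ### Theorem 1.8 (`α = 1`): Grönwall and continuation forms -/

/-- **Miller's Theorem 1.8 at `α = 1` (`p = 1`), Grönwall form on `T³`** (Pure Appl. Anal. 8 (2026),
Thm 1.8 = Thm 5.3: "`‖S(·,t)‖²_{Ḣ¹} ≤ ‖S⁰‖²_{Ḣ¹} exp(C₁ ∫₀ᵗ ‖P_{st}((u·∇)S + S² + ¾ω⊗ω)‖_{Ḣ¹}/‖S‖_{Ḣ¹} dτ)`"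
with the printed constant `C₁ = 2`, independent of `ν`). Along a classical solution of the unforced
Navier–Stokes equations with `ν ≥ 0` on `[a, b] × T^d` (`card d = 3`, frame `e`), if `Λ` is continuous
on `[a, b]` with `‖∇Q(s)‖_{L²} ≤ Λ(s) · (½‖Δu(s)‖₂²)^{1/2}` for all `s ∈ [a, b]`
(`‖∇Q‖²_{L²} = ∑_c∫∑_{ij}(∂_cQ_{ij})² = ‖Q‖²_{Ḣ¹}`, `(½‖Δu‖₂²)^{1/2} = ‖S‖_{Ḣ¹}`; `Λ = ‖Q‖_{Ḣ¹}/‖S‖_{Ḣ¹}`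
is the printed integrand), then `½‖Δu(t)‖₂² ≤ ½‖Δu(a)‖₂² · exp(2∫ₐᵗ Λ)` for every `t ∈ [a, b]`.
[cite: Miller2026StrainVorticity, Thm 1.8 (= Thm 5.3), case α = 1 (C₁ = 2)] -/
theorem Torus.half_laplacianSq_le_mul_exp_integral_of_strainProjection_grad_le (hd : Fintype.card d = 3)
    (e : d ≃ Fin 3) {ν a b : ℝ} (hν : 0 ≤ ν) (hab : a < b)
    {u : ℝ → UnitAddTorus d → EuclideanSpace ℝ d} {p : ℝ → UnitAddTorus d → ℝ}
    (h : Torus.IsClassicalNSSolutionOn (Icc a b) ν 0 u p)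
    {Λ : ℝ → ℝ} (hΛc : ContinuousOn Λ (Icc a b))
    (hΛ : ∀ s ∈ Icc a b,
      Real.sqrt (∑ c, ∫ x, ∑ i, ∑ j,
        Torus.partialDeriv c (Torus.strainProjection (Torus.strainPerturbation e (u s)) i j) x ^ 2) ≤
        Λ s * Real.sqrt (2⁻¹ * ∫ x, ‖Torus.laplacian (u s) x‖ ^ 2))
    {t : ℝ} (ht : t ∈ Icc a b) :
    2⁻¹ * ∫ x, ‖Torus.laplacian (u t) x‖ ^ 2 ≤
      (2⁻¹ * ∫ x, ‖Torus.laplacian (u a) x‖ ^ 2) * Real.exp (2 * ∫ s in a..t, Λ s) := by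
  set G : ℝ → ℝ := fun s => -ν * Torus.gradNormSq (Torus.laplacian (u s)) +
    2 * ∫ x, ∑ i, ∑ j, ((Torus.partialDeriv i (Torus.laplacian (u s)) x j +
      Torus.partialDeriv j (Torus.laplacian (u s)) x i) / 2) *
      Torus.strainProjection (Torus.strainPerturbation e (u s)) i j x with hG
  have hder : ∀ s ∈ Icc a b, HasDerivWithinAt (fun r => 2⁻¹ * ∫ x, ‖Torus.laplacian (u r) x‖ ^ 2)
      (G s) (Icc a b) s := fun s hs => h.hasDerivWithinAt_half_laplacianSq_strainProjection hd e hab hs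
  have hle : ∀ s ∈ Icc a b, G s ≤ (2 * Λ s) * (2⁻¹ * ∫ x, ‖Torus.laplacian (u s) x‖ ^ 2) := by
    intro s hs
    have hus : Torus.IsSmooth (u s) := h.smooth_velocity.isSmooth_slice hs
    have h1 := strainH1Flux_le_sqrt_mul_grad e hν hus (h.divFree s hs)
    set F : ℝ := 2⁻¹ * ∫ x, ‖Torus.laplacian (u s) x‖ ^ 2 with hF
    have hF0 : 0 ≤ F := mul_nonneg (by norm_num) (integral_nonneg fun x => sq_nonneg _)
    have hsF : 0 ≤ Real.sqrt F := Real.sqrt_nonneg _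
    have h2 : Real.sqrt F * Real.sqrt (∑ c, ∫ x, ∑ i, ∑ j,
        Torus.partialDeriv c (Torus.strainProjection (Torus.strainPerturbation e (u s)) i j) x ^ 2) ≤
        Real.sqrt F * (Λ s * Real.sqrt F) := mul_le_mul_of_nonneg_left (hΛ s hs) hsF
    have h3 : Real.sqrt F * (Λ s * Real.sqrt F) = Λ s * F := by
      rw [← mul_assoc, mul_comm (Real.sqrt F) (Λ s), mul_assoc, Real.mul_self_sqrt hF0]
    simp only [hG]
    linarith
  have hk : ContinuousOn (fun s => 2 * Λ s) (Icc a b) := continuousOn_const.mul hΛc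
  have hmain := le_mul_exp_integral_of_hasDerivWithinAt_le_mul hab hder hk hle ht
  rwa [intervalIntegral.integral_const_mul] at hmain

/-- **Miller's Theorem 1.8 at `α = 1`, continuation form on `T³`** ("in particular, if `T_max < +∞`
then `∫₀^{T_max} ‖Q‖_{Ḣ¹}/‖S‖_{Ḣ¹} dt = +∞`", Pure Appl. Anal. 8 (2026), (1.28) at `α = 1`): a classical
solution of the unforced Navier–Stokes equations (`ν > 0`) on `[0, T) × T^d` (`card d = 3`, `T > 0`,
mean-zero slices) for which some continuous `Λ` on `[0, T)` satisfies
`‖∇Q(t)‖_{L²} ≤ Λ(t)(½‖Δu(t)‖₂²)^{1/2}` and `∫₀ᵗ Λ ≤ I` for all `t ∈ [0, T)` continues to a classical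
solution on some `[0, T']`, `T' > T`. [cite: Miller2026StrainVorticity, Thm 1.8 (= Thm 5.3), case α = 1, display (1.28)] -/
theorem Torus.classicalNS_continuation_of_strainProjection_grad_integral_le (hd : Fintype.card d = 3)
    (e : d ≃ Fin 3) {ν T : ℝ} (hν : 0 < ν) (hT : 0 < T)
    {u : ℝ → UnitAddTorus d → EuclideanSpace ℝ d} {p : ℝ → UnitAddTorus d → ℝ}
    (h : Torus.IsClassicalNSSolutionOn (Ico 0 T) ν 0 u p)
    (hmean : ∀ t ∈ Ico 0 T, Torus.HasZeroMean (u t)) {Λ : ℝ → ℝ}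
    (hΛc : ContinuousOn Λ (Ico 0 T))
    (hΛ : ∀ t ∈ Ico 0 T,
      Real.sqrt (∑ c, ∫ x, ∑ i, ∑ j,
        Torus.partialDeriv c (Torus.strainProjection (Torus.strainPerturbation e (u t)) i j) x ^ 2) ≤
        Λ t * Real.sqrt (2⁻¹ * ∫ x, ‖Torus.laplacian (u t) x‖ ^ 2))
    {I : ℝ} (hI : ∀ t ∈ Ico 0 T, ∫ s in (0 : ℝ)..t, Λ s ≤ I) :
    ∃ T' : ℝ, T < T' ∧ ∃ (u' : ℝ → UnitAddTorus d → EuclideanSpace ℝ d)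
      (p' : ℝ → UnitAddTorus d → ℝ), Torus.IsClassicalNSSolutionOn (Icc 0 T') ν 0 u' p' ∧
        (∀ t ∈ Icc 0 T', Torus.HasZeroMean (u' t)) ∧ ∀ t ∈ Ico 0 T, u' t = u t := by
  have hI0 : 0 ≤ I := by
    have h0 := hI 0 ⟨le_rfl, hT⟩
    rwa [intervalIntegral.integral_same] at h0
  set F0 : ℝ := 2⁻¹ * ∫ x, ‖Torus.laplacian (u 0) x‖ ^ 2 with hF0
  have hF00 : 0 ≤ F0 := mul_nonneg (by norm_num) (integral_nonneg fun x => sq_nonneg _)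
  refine Torus.classicalNS_continuation_of_half_laplacianSq_le hd hν hT h hmean
    (B := F0 * Real.exp (2 * I)) fun t ht => ?_
  rcases ht.1.eq_or_lt with h0 | h0t
  · rw [← h0]
    exact le_mul_of_one_le_right hF00 (Real.one_le_exp (by positivity))
  · have hsub : Icc 0 t ⊆ Ico 0 T := fun s hs => ⟨hs.1, hs.2.trans_lt ht.2⟩
    have ht' : Torus.IsClassicalNSSolutionOn (Icc 0 t) ν 0 u p := h.mono hsub (uniqueDiffOn_Icc h0t)
    have hmain := Torus.half_laplacianSq_le_mul_exp_integral_of_strainProjection_grad_le hd e hν.le h0t ht'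
      (hΛc.mono hsub) (fun s hs => hΛ s (hsub hs)) ⟨h0t.le, le_rfl⟩
    have hexp : Real.exp (2 * ∫ s in (0 : ℝ)..t, Λ s) ≤ Real.exp (2 * I) :=
      Real.exp_le_exp.2 (mul_le_mul_of_nonneg_left (hI t ht) (by norm_num))
    exact hmain.trans (mul_le_mul_of_nonneg_left hexp hF00)

/-! ### Theorem 1.9: no blow-up while `‖Q‖_{L²} ≤ ν‖ΔS‖_{L²}` -/

/-- **Miller's Theorem 1.9 (= Thm 5.4), continuation form on `T³`** (Pure Appl. Anal. 8 (2026):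
"Suppose `u ∈ C([0,T_max);H³_{df})` is a mild solution of the Navier–Stokes equation. Then if
`T_max < +∞`, `limsup_{t→T_max} ‖P_{st}((u·∇)S + S² + ¾ω⊗ω)(·,t)‖_{L²}/‖−ΔS(·,t)‖_{L²} ≥ 1`").
Contrapositive, with viscosity `ν`: a classical solution of the unforced Navier–Stokes equations
(`ν > 0`) on `[0, T) × T^d` (`card d = 3`, `T > 0`, mean-zero slices, frame `e`) such that, from some
`t₀ ∈ [0, T)` on, `‖Q(t)‖_{L²} ≤ ν ‖ΔS(t)‖_{L²}` (`(∫∑Q²)^{1/2} ≤ ν(∫∑(ΔS)²)^{1/2}`,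
`(ΔS)_{ij} = ½((∂ᵢΔu)ⱼ + (∂ⱼΔu)ᵢ)`), continues to a classical solution on some `[0, T']`, `T' > T`:
`½‖Δu‖₂² = ‖S‖²_{Ḣ¹}` is non-increasing on `[t₀, T)` (flux `≤ 0`,
`StrainProjectionCriterion.strainH1Flux_nonpos_of_le`), bounded on `[0, t₀]` by continuity, hence
bounded on `[0, T)`. The printed strict inequality `< 1` on `(T_max − ε, T_max)` is only used to reach
this situation; the non-strict hypothesis suffices. [cite: Miller2026StrainVorticity, Thm 1.9 (= Thm 5.4)] -/
theorem Torus.classicalNS_continuation_of_strainProjection_le (hd : Fintype.card d = 3)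
    (e : d ≃ Fin 3) {ν T : ℝ} (hν : 0 < ν) (hT : 0 < T)
    {u : ℝ → UnitAddTorus d → EuclideanSpace ℝ d} {p : ℝ → UnitAddTorus d → ℝ}
    (h : Torus.IsClassicalNSSolutionOn (Ico 0 T) ν 0 u p)
    (hmean : ∀ t ∈ Ico 0 T, Torus.HasZeroMean (u t)) {t₀ : ℝ} (ht₀ : t₀ ∈ Ico 0 T)
    (hQ : ∀ t ∈ Ico t₀ T,
      Real.sqrt (∫ x, ∑ i, ∑ j, Torus.strainProjection (Torus.strainPerturbation e (u t)) i j x ^ 2) ≤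
        ν * Real.sqrt (∫ x, ∑ i, ∑ j, ((Torus.partialDeriv i (Torus.laplacian (u t)) x j +
          Torus.partialDeriv j (Torus.laplacian (u t)) x i) / 2) ^ 2)) :
    ∃ T' : ℝ, T < T' ∧ ∃ (u' : ℝ → UnitAddTorus d → EuclideanSpace ℝ d)
      (p' : ℝ → UnitAddTorus d → ℝ), Torus.IsClassicalNSSolutionOn (Icc 0 T') ν 0 u' p' ∧
        (∀ t ∈ Icc 0 T', Torus.HasZeroMean (u' t)) ∧ ∀ t ∈ Ico 0 T, u' t = u t := by
  set F : ℝ → ℝ := fun t => 2⁻¹ * ∫ x, ‖Torus.laplacian (u t) x‖ ^ 2 with hF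
  -- `F` is bounded on the compact `[0, t₀]`
  have hcont : ContinuousOn F (Icc 0 t₀) :=
    (continuousOn_half_laplacianSq h).mono fun s hs => ⟨hs.1, hs.2.trans_lt ht₀.2⟩
  obtain ⟨B, hB⟩ := (isCompact_Icc : IsCompact (Icc (0 : ℝ) t₀)).bddAbove_image hcont
  have hB' : ∀ s ∈ Icc 0 t₀, F s ≤ B := fun s hs => hB ⟨s, hs, rfl⟩
  refine Torus.classicalNS_continuation_of_half_laplacianSq_le hd hν hT h hmean (B := B) fun t ht => ?_
  by_cases hle : t ≤ t₀
  · exact hB' t ⟨ht.1, hle⟩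
  · -- `t₀ < t`: `F` is non-increasing on `[t₀, t]`
    have ht₀t : t₀ < t := lt_of_not_ge hle
    have hsub : Icc t₀ t ⊆ Ico 0 T := fun s hs => ⟨ht₀.1.trans hs.1, hs.2.trans_lt ht.2⟩
    have ht' : Torus.IsClassicalNSSolutionOn (Icc t₀ t) ν 0 u p := h.mono hsub (uniqueDiffOn_Icc ht₀t)
    set G : ℝ → ℝ := fun s => -ν * Torus.gradNormSq (Torus.laplacian (u s)) +
      2 * ∫ x, ∑ i, ∑ j, ((Torus.partialDeriv i (Torus.laplacian (u s)) x j +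
        Torus.partialDeriv j (Torus.laplacian (u s)) x i) / 2) *
        Torus.strainProjection (Torus.strainPerturbation e (u s)) i j x with hG
    have hder : ∀ s ∈ Icc t₀ t, HasDerivWithinAt F (G s) (Icc t₀ t) s := fun s hs =>
      ht'.hasDerivWithinAt_half_laplacianSq_strainProjection hd e ht₀t hs
    have hle0 : ∀ s ∈ Icc t₀ t, G s ≤ 0 * F s := by
      intro s hs
      rw [zero_mul]
      exact strainH1Flux_nonpos_of_le e (ht'.smooth_velocity.isSmooth_slice hs) (ht'.divFree s hs)
        (hQ s ⟨hs.1, (hsub hs).2⟩)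
    have hmain := le_mul_exp_integral_of_hasDerivWithinAt_le_mul ht₀t hder continuousOn_const hle0
      ⟨ht₀t.le, le_rfl⟩
    rw [intervalIntegral.integral_zero, Real.exp_zero, mul_one] at hmain
    exact hmain.trans (hB' t₀ ⟨ht₀.1, le_rfl⟩)

open UnitAddTorus Literature.Analysis.FunctionSpaces.Torus

/-! ### Theorem 1.8 for `0 < α < 1`: fractional Sobolev seminorms of matrix fields, Fourier side -/

/-- **The homogeneous `Ḣˢ` seminorm (squared) of a matrix field on the unit torus, in Miller's
normalisation**: for `M : d → d → T^d → ℝ`,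
`‖M‖²_{Ḣˢ} = ∑ₐ ∑_k (4π²|k|²)ˢ ‖𝓕(Mₐ.)(k)‖²`, the rows `x ↦ (M a b x)_b` being read as vector
fields `T^d → ℝ^d` and `𝓕` their (complexified) Fourier coefficients. The weight `(2π|k|)^{2s}` is
the one for which `‖M‖_{Ḣ¹} = ‖∇M‖_{L²}` and `‖M‖_{Ḣ²} = ‖ΔM‖_{L²}` on `T^d = ℝ^d/ℤ^d`
(`𝓕(∂ⱼf)(k) = 2πi kⱼ f̂(k)`), i.e. the normalisation of Miller's `Ḣ^α_{st}` ("defined entirely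
analogously", §2) used in `‖−ΔS‖_{Ḣ^{-1}} = ‖S‖_{Ḣ¹}` (proof of Thm 5.3) and in the strain isometry
`‖S‖²_{Ḣ^α} = ½‖∇u‖²_{Ḣ^α}` (Prop 2.5); see `Torus.matrixHsSeminormSq_one_symGrad` below for
`‖∇_{sym}v‖²_{Ḣ¹} = ½‖Δv‖₂²`. (The `k = 0` term vanishes for `s ≠ 0`, `0ˢ = 0`.)
[cite: Miller2026StrainVorticity, §2 (spaces `Ḣ^α_{st}`) and Prop 2.5; Grafakos2014, Prop. 3.2.7 (3)] -/
noncomputable def Torus.matrixHsSeminormSq (s : ℝ) (M : d → d → UnitAddTorus d → ℝ) : ℝ :=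
  ∑ a, ∑' k : d → ℤ, (4 * Real.pi ^ 2 * freqNormSq k) ^ s *
    ‖mFourierCoeff (EuclideanSpace.complexify ∘ fun x =>
      (WithLp.toLp 2 fun b => M a b x : EuclideanSpace ℝ d)) k‖ ^ 2

namespace StrainProjectionCriterion

/-! #### Rows of matrix fields as vector fields; the spectral weight `4π²|k|²` -/

/-- Row `a` of a matrix field, as a vector field `x ↦ (M a b x)_b`. [folklore] -/
private def mrow (M : d → d → UnitAddTorus d → ℝ) (a : d) : UnitAddTorus d → EuclideanSpace ℝ d :=
  fun x => WithLp.toLp 2 fun b => M a b x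

omit [Fintype d] [DecidableEq d] in
/-- Entries of a row field: `(mrow M a x)_b = M a b x`. [folklore] -/
private theorem mrow_apply (M : d → d → UnitAddTorus d → ℝ) (a b : d) (x : UnitAddTorus d) :
    mrow M a x b = M a b x := rfl

omit [DecidableEq d] in
/-- Rows of a smooth matrix field are smooth vector fields. [folklore] -/
private theorem isSmooth_mrow {M : d → d → UnitAddTorus d → ℝ} (hM : ∀ a b, Torus.IsSmooth (M a b))
    (a : d) : Torus.IsSmooth (mrow M a) := by
  unfold Torus.IsSmooth
  rw [contDiff_piLp]
  intro b
  exact hM a b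

omit [DecidableEq d] in
/-- Unfolding of `Torus.matrixHsSeminormSq` in terms of rows. [folklore] -/
private theorem matrixHsSeminormSq_eq (s : ℝ) (M : d → d → UnitAddTorus d → ℝ) :
    Torus.matrixHsSeminormSq s M = ∑ a, ∑' k : d → ℤ, (4 * Real.pi ^ 2 * freqNormSq k) ^ s *
      ‖mFourierCoeff (EuclideanSpace.complexify ∘ mrow M a) k‖ ^ 2 := rfl

omit [DecidableEq d] in
/-- The spectral weight `4π²|k|²` is nonnegative. [folklore] -/
private theorem weight_nonneg (k : d → ℤ) : 0 ≤ 4 * Real.pi ^ 2 * freqNormSq k := by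
  have := freqNormSq_nonneg k
  positivity

omit [DecidableEq d] in
/-- `(4π²|k|²)ˢ = (4π²)ˢ |k|^{2s}`. [folklore] -/
private theorem weight_rpow (s : ℝ) (k : d → ℤ) :
    (4 * Real.pi ^ 2 * freqNormSq k) ^ s = (4 * Real.pi ^ 2) ^ s * freqNormSq k ^ s :=
  Real.mul_rpow (by positivity) (freqNormSq_nonneg k)

/-- Weighted spectral sums of a smooth vector field are summable for every weight exponent
`s ≥ 0` (rapid decay of the Fourier coefficients). [folklore] -/
private theorem summable_weight_rpow_mul {v : UnitAddTorus d → EuclideanSpace ℝ d}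
    (hv : Torus.IsSmooth v) {s : ℝ} (hs : 0 ≤ s) :
    Summable fun k : d → ℤ => (4 * Real.pi ^ 2 * freqNormSq k) ^ s *
      ‖mFourierCoeff (EuclideanSpace.complexify ∘ v) k‖ ^ 2 := by
  have h := (hv.summable_freqNormSq_rpow_mul_norm_sq hs).mul_left ((4 * Real.pi ^ 2) ^ s)
  refine h.congr fun k => ?_
  rw [weight_rpow, mul_assoc]

/-- **Spectral `Ḣ¹` seminorm** `∑ₖ 4π²|k|² ‖v̂(k)‖² = ‖∇v‖₂²` for smooth `v` (Parseval for each
`∂ᵢv`, `𝓕(∂ᵢv)(k) = 2πi kᵢ v̂(k)`; private copy of `NSGevrey.hasSum_freqNormSq_mul_norm_sq_mFourierCoeff`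
to keep the imports of this file light). [folklore] -/
private theorem hasSum_weight_mul {v : UnitAddTorus d → EuclideanSpace ℝ d} (hv : Torus.IsSmooth v) :
    HasSum (fun k : d → ℤ => 4 * Real.pi ^ 2 * freqNormSq k *
      ‖mFourierCoeff (EuclideanSpace.complexify ∘ v) k‖ ^ 2) (Torus.gradNormSq v) := by
  have hi : ∀ i : d, HasSum (fun k : d → ℤ =>
      ‖mFourierCoeff (EuclideanSpace.complexify ∘ Torus.partialDeriv i v) k‖ ^ 2)
      (∫ x, ‖Torus.partialDeriv i v x‖ ^ 2) := fun i =>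
    hasSum_sq_norm_mFourierCoeff_complexify ((hv.partialDeriv i).memLp 2)
  have hsum := hasSum_sum (s := Finset.univ) fun i _ => hi i
  have hval : ∑ i, ∫ x, ‖Torus.partialDeriv i v x‖ ^ 2 = Torus.gradNormSq v := by
    rw [Torus.gradNormSq, ← MeasureTheory.integral_finsetSum _
      (f := fun i x => ‖Torus.partialDeriv i v x‖ ^ 2) fun i _ =>
      (((hv.partialDeriv i).continuous.norm.pow 2).integrable_unitAddTorus)]
  rw [hval] at hsum
  refine hsum.congr_fun fun k => ?_
  simp only [mFourierCoeff_complexify_partialDeriv hv, norm_smul]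
  rw [freqNormSq, Finset.mul_sum, Finset.sum_mul]
  refine Finset.sum_congr rfl fun i _ => ?_
  have : ‖(2 * Real.pi * Complex.I * (k i : ℂ) : ℂ)‖ = 2 * Real.pi * |(k i : ℝ)| := by
    simp [abs_of_pos Real.pi_pos]
  rw [this, mul_pow, mul_pow, sq_abs]
  ring

/-- **Spectral `Ḣ²` seminorm** `∑ₖ (4π²|k|²)² ‖v̂(k)‖² = ∫ ‖Δv‖²` for smooth `v` (Parseval for `Δv`,
`𝓕(Δv)(k) = −4π²|k|² v̂(k)`; private copy of the `NSGevrey` lemma). [folklore] -/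
private theorem hasSum_weight_sq_mul {v : UnitAddTorus d → EuclideanSpace ℝ d} (hv : Torus.IsSmooth v) :
    HasSum (fun k : d → ℤ => (4 * Real.pi ^ 2 * freqNormSq k) ^ 2 *
      ‖mFourierCoeff (EuclideanSpace.complexify ∘ v) k‖ ^ 2) (∫ x, ‖Torus.laplacian v x‖ ^ 2) := by
  have h := hasSum_sq_norm_mFourierCoeff_complexify (hv.laplacian.memLp 2)
  refine h.congr_fun fun k => ?_
  rw [mFourierCoeff_complexify_laplacian hv, norm_neg, norm_smul, Complex.norm_real, Real.norm_eq_abs,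
    abs_of_nonneg (weight_nonneg k), mul_pow]
  ring

/-- `rpow` forms: `∑ₖ (4π²|k|²)¹ ‖v̂(k)‖² = ‖∇v‖₂²`. [folklore] -/
private theorem tsum_weight_rpow_one {v : UnitAddTorus d → EuclideanSpace ℝ d} (hv : Torus.IsSmooth v) :
    ∑' k : d → ℤ, (4 * Real.pi ^ 2 * freqNormSq k) ^ (1 : ℝ) *
      ‖mFourierCoeff (EuclideanSpace.complexify ∘ v) k‖ ^ 2 = Torus.gradNormSq v := by
  rw [← (hasSum_weight_mul hv).tsum_eq]
  exact tsum_congr fun k => by rw [Real.rpow_one]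

/-- `rpow` forms: `∑ₖ (4π²|k|²)² ‖v̂(k)‖² = ∫‖Δv‖²`. [folklore] -/
private theorem tsum_weight_rpow_two {v : UnitAddTorus d → EuclideanSpace ℝ d} (hv : Torus.IsSmooth v) :
    ∑' k : d → ℤ, (4 * Real.pi ^ 2 * freqNormSq k) ^ (2 : ℝ) *
      ‖mFourierCoeff (EuclideanSpace.complexify ∘ v) k‖ ^ 2 = ∫ x, ‖Torus.laplacian v x‖ ^ 2 := by
  rw [← (hasSum_weight_sq_mul hv).tsum_eq]
  exact tsum_congr fun k => by rw [Real.rpow_two]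

/-- `‖𝓕(Δv)(k)‖ = 4π²|k|² ‖v̂(k)‖`. [folklore] -/
private theorem norm_mFourierCoeff_laplacian {v : UnitAddTorus d → EuclideanSpace ℝ d}
    (hv : Torus.IsSmooth v) (k : d → ℤ) :
    ‖mFourierCoeff (EuclideanSpace.complexify ∘ Torus.laplacian v) k‖ =
      4 * Real.pi ^ 2 * freqNormSq k * ‖mFourierCoeff (EuclideanSpace.complexify ∘ v) k‖ := by
  rw [mFourierCoeff_complexify_laplacian hv, norm_neg, norm_smul, Complex.norm_real, Real.norm_eq_abs,
    abs_of_nonneg (weight_nonneg k)]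

/-! #### API of `Torus.matrixHsSeminormSq`: nonnegativity and the integer levels `s = 0, 1, 2` -/

omit [DecidableEq d] in
/-- `‖M‖²_{Ḣˢ} ≥ 0`. [cite: Miller2026StrainVorticity, §2] -/
theorem _root_.Literature.Analysis.FluidPDE.Torus.matrixHsSeminormSq_nonneg (s : ℝ)
    (M : d → d → UnitAddTorus d → ℝ) : 0 ≤ Torus.matrixHsSeminormSq s M :=
  Finset.sum_nonneg fun _ _ => tsum_nonneg fun k =>
    mul_nonneg (Real.rpow_nonneg (weight_nonneg k) _) (sq_nonneg _)

omit [DecidableEq d] in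
/-- `‖v‖² = ∑_b v_b²` for the row fields. [folklore] -/
private theorem norm_sq_eq_sum_sq (w : EuclideanSpace ℝ d) : ‖w‖ ^ 2 = ∑ b, w b ^ 2 := by
  rw [EuclideanSpace.norm_sq_eq]
  exact Finset.sum_congr rfl fun b _ => by rw [Real.norm_eq_abs, sq_abs]

omit [DecidableEq d] in
/-- **Level `s = 0`**: `‖M‖²_{Ḣ⁰} = ∫ ∑ₐᵦ Mₐᵦ²` (Parseval, row by row) for a smooth matrix field.
[cite: Miller2026StrainVorticity, §2; Grafakos2014, Prop. 3.2.7 (3)] -/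
theorem _root_.Literature.Analysis.FluidPDE.Torus.matrixHsSeminormSq_zero
    {M : d → d → UnitAddTorus d → ℝ} (hM : ∀ a b, Torus.IsSmooth (M a b)) :
    Torus.matrixHsSeminormSq 0 M = ∫ x, ∑ a, ∑ b, M a b x ^ 2 := by
  rw [matrixHsSeminormSq_eq, MeasureTheory.integral_finsetSum _ fun a _ =>
    (isSmooth_sum' _ fun b _ => smooth_sq' (hM a b)).integrable]
  refine Finset.sum_congr rfl fun a _ => ?_
  have h := (hasSum_sq_norm_mFourierCoeff_complexify ((isSmooth_mrow hM a).memLp 2)).tsum_eq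
  have h' : ∑' k : d → ℤ, (4 * Real.pi ^ 2 * freqNormSq k) ^ (0 : ℝ) *
      ‖mFourierCoeff (EuclideanSpace.complexify ∘ mrow M a) k‖ ^ 2 =
      ∑' k : d → ℤ, ‖mFourierCoeff (EuclideanSpace.complexify ∘ mrow M a) k‖ ^ 2 :=
    tsum_congr fun k => by rw [Real.rpow_zero, one_mul]
  rw [h', h]
  refine integral_congr_ae (ae_of_all _ fun x => ?_)
  simp only [norm_sq_eq_sum_sq, mrow_apply]

/-- **Level `s = 1`**: `‖M‖²_{Ḣ¹} = ∑_c ∫ ∑ₐᵦ (∂_c Mₐᵦ)² = ‖∇M‖₂²` for a smooth matrix field.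
[cite: Miller2026StrainVorticity, §2; Grafakos2014, Prop. 3.2.7 (3)] -/
theorem _root_.Literature.Analysis.FluidPDE.Torus.matrixHsSeminormSq_one
    {M : d → d → UnitAddTorus d → ℝ} (hM : ∀ a b, Torus.IsSmooth (M a b)) :
    Torus.matrixHsSeminormSq 1 M = ∑ c, ∫ x, ∑ a, ∑ b, Torus.partialDeriv c (M a b) x ^ 2 := by
  rw [matrixHsSeminormSq_eq]
  have hrow : ∀ a, ∑' k : d → ℤ, (4 * Real.pi ^ 2 * freqNormSq k) ^ (1 : ℝ) *
      ‖mFourierCoeff (EuclideanSpace.complexify ∘ mrow M a) k‖ ^ 2 =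
      ∑ c, ∫ x, ∑ b, Torus.partialDeriv c (M a b) x ^ 2 := by
    intro a
    rw [tsum_weight_rpow_one (isSmooth_mrow hM a), Torus.gradNormSq,
      ← MeasureTheory.integral_finsetSum _ fun c _ =>
        (isSmooth_sum' _ fun b _ => smooth_sq' ((hM a b).partialDeriv c)).integrable]
    refine integral_congr_ae (ae_of_all _ fun x => Finset.sum_congr rfl fun c _ => ?_)
    rw [norm_sq_eq_sum_sq]
    refine Finset.sum_congr rfl fun b _ => ?_
    rw [← Torus.partialDeriv_apply_coord ((isSmooth_mrow hM a).isContDiff (by simp))]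
    rfl
  simp_rw [hrow]
  rw [Finset.sum_comm]
  refine Finset.sum_congr rfl fun c _ => ?_
  rw [← MeasureTheory.integral_finsetSum _ fun a _ =>
    (isSmooth_sum' _ fun b _ => smooth_sq' ((hM a b).partialDeriv c)).integrable]

/-! #### The strain rows `Sₐ = (S_{ab})_b` of a velocity field and their Laplacians -/

/-- The strain matrix field `S_{ab} = ½((∂_a v)_b + (∂_b v)_a)` of a velocity field. [folklore] -/
private noncomputable def strainM (v : UnitAddTorus d → EuclideanSpace ℝ d) : d → d → UnitAddTorus d → ℝ :=
  fun a b x => (Torus.partialDeriv a v x b + Torus.partialDeriv b v x a) / 2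

/-- Unfolding of the strain entries. [folklore] -/
private theorem strainM_apply (v : UnitAddTorus d → EuclideanSpace ℝ d) (a b : d) (x : UnitAddTorus d) :
    strainM v a b x = (Torus.partialDeriv a v x b + Torus.partialDeriv b v x a) / 2 := rfl

/-- Strain entries of a smooth field are smooth. [folklore] -/
private theorem isSmooth_strainM {v : UnitAddTorus d → EuclideanSpace ℝ d} (hv : Torus.IsSmooth v)
    (a b : d) : Torus.IsSmooth (strainM v a b) :=
  (((hv.partialDeriv a).apply b).add ((hv.partialDeriv b).apply a)).div_const 2

/-- `Δ` of a velocity component commutes with `∂ₐ`: `Δ(y ↦ (∂ₐv(y))_b)(x) = (∂ₐΔv(x))_b`. [folklore] -/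
private theorem laplacian_partialDeriv_apply {v : UnitAddTorus d → EuclideanSpace ℝ d}
    (hv : Torus.IsSmooth v) (a b : d) (x : UnitAddTorus d) :
    Torus.laplacian (fun y => Torus.partialDeriv a v y b) x =
      Torus.partialDeriv a (Torus.laplacian v) x b := by
  have h1 : (fun y => Torus.partialDeriv a v y b) = Torus.partialDeriv a (fun y => v y b) := by
    funext y; exact (Torus.partialDeriv_apply_coord (hv.isContDiff (by simp)) a y b).symm
  rw [h1, ← Torus.partialDeriv_laplacian_comm (hv.apply b),
    ← Torus.partialDeriv_apply_coord (hv.laplacian.isContDiff (by simp)) a x b]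
  congr 1
  funext y
  exact (laplacian_apply_eq_laplacian_coord' hv b y).symm

/-- **The Laplacian of a strain row is the strain row of the Laplacian**:
`(Δ Sₐ)(x)_b = ½((∂ₐΔv)_b + (∂_bΔv)_a)(x)`. [folklore] -/
private theorem laplacian_mrow_strainM_apply {v : UnitAddTorus d → EuclideanSpace ℝ d}
    (hv : Torus.IsSmooth v) (a b : d) (x : UnitAddTorus d) :
    Torus.laplacian (mrow (strainM v) a) x b =
      (Torus.partialDeriv a (Torus.laplacian v) x b + Torus.partialDeriv b (Torus.laplacian v) x a) / 2 := by
  have hS := isSmooth_mrow (isSmooth_strainM hv) a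
  rw [laplacian_apply_eq_laplacian_coord' hS b]
  show Torus.laplacian (fun y => (Torus.partialDeriv a v y b + Torus.partialDeriv b v y a) / 2) x = _
  have hA : Torus.IsSmooth (fun y => Torus.partialDeriv a v y b) := (hv.partialDeriv a).apply b
  have hB : Torus.IsSmooth (fun y => Torus.partialDeriv b v y a) := (hv.partialDeriv b).apply a
  have hfun : (fun y => (Torus.partialDeriv a v y b + Torus.partialDeriv b v y a) / 2) =
      (2⁻¹ : ℝ) • ((fun y => Torus.partialDeriv a v y b) + fun y => Torus.partialDeriv b v y a) := by
    funext y; simp [div_eq_inv_mul]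
  have hadd : Torus.laplacian ((fun y => Torus.partialDeriv a v y b) + fun y => Torus.partialDeriv b v y a) x =
      Torus.laplacian (fun y => Torus.partialDeriv a v y b) x +
        Torus.laplacian (fun y => Torus.partialDeriv b v y a) x := Torus.laplacian_add_apply hA hB x
  rw [hfun, Torus.laplacian_const_smul_apply (hA.add hB), hadd, smul_eq_mul,
    laplacian_partialDeriv_apply hv, laplacian_partialDeriv_apply hv]
  ring

/-- **`‖∇_{sym}v‖²_{Ḣ¹} = ½‖Δv‖₂²`** for a smooth divergence-free field on `T^d`: the level-one
matrix seminorm of the strain is Miller's `‖S‖²_{Ḣ¹}` (`= ½‖∇u‖²_{Ḣ¹}`, Prop 2.5), i.e. the quantity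
`½∫‖Δu‖²` of the `Ḣ¹`-strain balance of this file. [cite: Miller2026StrainVorticity, Prop 2.5] -/
theorem _root_.Literature.Analysis.FluidPDE.Torus.matrixHsSeminormSq_one_symGrad
    {v : UnitAddTorus d → EuclideanSpace ℝ d} (hv : Torus.IsSmooth v) (hdiv : Torus.IsDivFree v) :
    Torus.matrixHsSeminormSq 1
        (fun a b x => (Torus.partialDeriv a v x b + Torus.partialDeriv b v x a) / 2) =
      2⁻¹ * ∫ x, ‖Torus.laplacian v x‖ ^ 2 := by
  rw [← sum_integral_sum_partialDeriv_strain_sq_eq hv hdiv]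
  exact Torus.matrixHsSeminormSq_one (isSmooth_strainM hv)

/-- **`‖∇_{sym}v‖²_{Ḣ²} = ‖Δ∇_{sym}v‖₂² = ∫∑ₐᵦ (½((∂ₐΔv)_b + (∂_bΔv)ₐ))²`** for a smooth field on
`T^d` (the `L²` norm of `−ΔS`, the dissipation of the `Ḣ¹`-strain balance).
[cite: Miller2026StrainVorticity, Prop 2.5 and (5.10)] -/
theorem _root_.Literature.Analysis.FluidPDE.Torus.matrixHsSeminormSq_two_symGrad
    {v : UnitAddTorus d → EuclideanSpace ℝ d} (hv : Torus.IsSmooth v) :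
    Torus.matrixHsSeminormSq 2
        (fun a b x => (Torus.partialDeriv a v x b + Torus.partialDeriv b v x a) / 2) =
      ∫ x, ∑ a, ∑ b, ((Torus.partialDeriv a (Torus.laplacian v) x b +
        Torus.partialDeriv b (Torus.laplacian v) x a) / 2) ^ 2 := by
  have hS := isSmooth_strainM hv
  have hLS : ∀ a b, Torus.IsSmooth (fun x => (Torus.partialDeriv a (Torus.laplacian v) x b +
      Torus.partialDeriv b (Torus.laplacian v) x a) / 2) := fun a b =>
    (((hv.laplacian.partialDeriv a).apply b).add ((hv.laplacian.partialDeriv b).apply a)).div_const 2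
  show Torus.matrixHsSeminormSq 2 (strainM v) = _
  rw [matrixHsSeminormSq_eq, MeasureTheory.integral_finsetSum _ fun a _ =>
    (isSmooth_sum' _ fun b _ => smooth_sq' (hLS a b)).integrable]
  refine Finset.sum_congr rfl fun a _ => ?_
  rw [tsum_weight_rpow_two (isSmooth_mrow hS a)]
  refine integral_congr_ae (ae_of_all _ fun x => ?_)
  simp only [norm_sq_eq_sum_sq, laplacian_mrow_strainM_apply hv]

/-- The flux pairing of the `Ḣ¹`-strain balance, row by row:
`∫∑ₐᵦ (ΔS)ₐᵦ Qₐᵦ = ∑ₐ ∫ ⟪ΔSₐ, Qₐ⟫`. [folklore] -/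
private theorem integral_sum_laplacianStrain_mul_eq_sum_inner {v : UnitAddTorus d → EuclideanSpace ℝ d}
    (hv : Torus.IsSmooth v) {Q : d → d → UnitAddTorus d → ℝ} (hQ : ∀ a b, Torus.IsSmooth (Q a b)) :
    ∫ x, ∑ a, ∑ b, ((Torus.partialDeriv a (Torus.laplacian v) x b +
        Torus.partialDeriv b (Torus.laplacian v) x a) / 2) * Q a b x =
      ∑ a, ∫ x, ⟪Torus.laplacian (mrow (strainM v) a) x, mrow Q a x⟫ := by
  have hLS : ∀ a b, Torus.IsSmooth (fun x => (Torus.partialDeriv a (Torus.laplacian v) x b +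
      Torus.partialDeriv b (Torus.laplacian v) x a) / 2) := fun a b =>
    (((hv.laplacian.partialDeriv a).apply b).add ((hv.laplacian.partialDeriv b).apply a)).div_const 2
  rw [MeasureTheory.integral_finsetSum _ fun a _ =>
    (isSmooth_sum' _ fun b _ => smooth_mul' (hLS a b) (hQ a b)).integrable]
  refine Finset.sum_congr rfl fun a _ => integral_congr_ae (ae_of_all _ fun x => ?_)
  simp only [PiLp.inner_apply, laplacian_mrow_strainM_apply hv, mrow_apply, RCLike.inner_apply,
    conj_trivial]
  exact Finset.sum_congr rfl fun b _ => mul_comm _ _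

/-! #### Duality `Ḣ^{-α} × Ḣ^{α}` and the interpolation `‖ΔS‖_{Ḣ^{-α}} ≤ ‖S‖^α_{Ḣ¹}‖ΔS‖^{1-α}_{L²}` -/

/-- **Duality on the Fourier side**: for smooth `v, w : T^d → ℝ^d` and `0 < α < 2`,
`∫⟪Δv, w⟫ ≤ (∑ₖ (4π²|k|²)^{2−α}‖v̂(k)‖²)^{1/2} (∑ₖ (4π²|k|²)^{α}‖ŵ(k)‖²)^{1/2}`
(`= ‖Δv‖_{Ḣ^{-α}} ‖w‖_{Ḣ^α}`; Parseval for `⟪Δv, w⟫`, `‖𝓕Δv(k)‖ = 4π²|k|²‖v̂(k)‖`, Cauchy–Schwarz in `ℓ²`).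
[folklore] -/
private theorem integral_inner_laplacian_le_sqrt_mul_sqrt {v w : UnitAddTorus d → EuclideanSpace ℝ d}
    (hv : Torus.IsSmooth v) (hw : Torus.IsSmooth w) {α : ℝ} (hα0 : 0 < α) (hα2 : α < 2) :
    ∫ x, ⟪Torus.laplacian v x, w x⟫ ≤
      Real.sqrt (∑' k : d → ℤ, (4 * Real.pi ^ 2 * freqNormSq k) ^ (2 - α) *
          ‖mFourierCoeff (EuclideanSpace.complexify ∘ v) k‖ ^ 2) *
        Real.sqrt (∑' k : d → ℤ, (4 * Real.pi ^ 2 * freqNormSq k) ^ α *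
          ‖mFourierCoeff (EuclideanSpace.complexify ∘ w) k‖ ^ 2) := by
  have hpar := hasSum_re_inner_mFourierCoeff_complexify (hv.laplacian.memLp 2) (hw.memLp 2)
  rw [← hpar.tsum_eq]
  set cv : (d → ℤ) → EuclideanSpace ℂ d := fun k => mFourierCoeff (EuclideanSpace.complexify ∘ v) k
    with hcv
  set cw : (d → ℤ) → EuclideanSpace ℂ d := fun k => mFourierCoeff (EuclideanSpace.complexify ∘ w) k
    with hcw
  set W : (d → ℤ) → ℝ := fun k => 4 * Real.pi ^ 2 * freqNormSq k with hW
  have hW0 : ∀ k, 0 ≤ W k := fun k => weight_nonneg k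
  set f : (d → ℤ) → ℝ := fun k => W k ^ ((2 - α) / 2) * ‖cv k‖ with hf
  set g : (d → ℤ) → ℝ := fun k => W k ^ (α / 2) * ‖cw k‖ with hg
  have hf0 : ∀ k, 0 ≤ f k := fun k => mul_nonneg (Real.rpow_nonneg (hW0 k) _) (norm_nonneg _)
  have hg0 : ∀ k, 0 ≤ g k := fun k => mul_nonneg (Real.rpow_nonneg (hW0 k) _) (norm_nonneg _)
  have hf2 : ∀ k, f k ^ (2 : ℝ) = W k ^ (2 - α) * ‖cv k‖ ^ 2 := by
    intro k
    simp only [hf]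
    rw [Real.mul_rpow (Real.rpow_nonneg (hW0 k) _) (norm_nonneg _), ← Real.rpow_mul (hW0 k),
      Real.rpow_two]
    congr 2
    ring
  have hg2 : ∀ k, g k ^ (2 : ℝ) = W k ^ α * ‖cw k‖ ^ 2 := by
    intro k
    simp only [hg]
    rw [Real.mul_rpow (Real.rpow_nonneg (hW0 k) _) (norm_nonneg _), ← Real.rpow_mul (hW0 k),
      Real.rpow_two]
    congr 2
    ring
  have hfs : Summable fun k => f k ^ (2 : ℝ) := by
    simp_rw [hf2]
    exact summable_weight_rpow_mul hv (by linarith)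
  have hgs : Summable fun k => g k ^ (2 : ℝ) := by
    simp_rw [hg2]
    exact summable_weight_rpow_mul hw hα0.le
  -- termwise bound `Re⟪𝓕Δv(k), ŵ(k)⟫ ≤ f k * g k`
  have hterm : ∀ k, (inner ℂ (mFourierCoeff (EuclideanSpace.complexify ∘ Torus.laplacian v) k) (cw k)).re ≤
      f k * g k := by
    intro k
    have h1 := (Complex.re_le_norm _).trans
      (norm_inner_le_norm (𝕜 := ℂ) (mFourierCoeff (EuclideanSpace.complexify ∘ Torus.laplacian v) k) (cw k))
    rw [norm_mFourierCoeff_laplacian hv] at h1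
    have e : f k * g k = W k * ‖cv k‖ * ‖cw k‖ := by
      simp only [hf, hg]
      have hexp1 : (2 - α) / 2 + α / 2 = 1 := by ring
      have hW1 : W k ^ ((2 - α) / 2) * W k ^ (α / 2) = W k := by
        rw [← Real.rpow_add' (hW0 k) (by rw [hexp1]; exact one_ne_zero), hexp1, Real.rpow_one]
      calc W k ^ ((2 - α) / 2) * ‖cv k‖ * (W k ^ (α / 2) * ‖cw k‖)
          = (W k ^ ((2 - α) / 2) * W k ^ (α / 2)) * ‖cv k‖ * ‖cw k‖ := by ring
        _ = W k * ‖cv k‖ * ‖cw k‖ := by rw [hW1]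
    rw [e]
    exact h1
  -- summability of `f g` (by `2fg ≤ f² + g²`)
  have hfg : Summable fun k => f k * g k := by
    refine Summable.of_nonneg_of_le (fun k => mul_nonneg (hf0 k) (hg0 k)) (fun k => ?_)
      ((hfs.add hgs).mul_left 2⁻¹)
    have := two_mul_le_add_sq (f k) (g k)
    rw [← Real.rpow_two, ← Real.rpow_two] at this
    linarith
  have hle1 : ∑' k, (inner ℂ (mFourierCoeff (EuclideanSpace.complexify ∘ Torus.laplacian v) k) (cw k)).re ≤
      ∑' k, f k * g k := Summable.tsum_le_tsum hterm hpar.summable hfg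
  have hcs := Real.inner_le_Lp_mul_Lq_tsum_of_nonneg
    (Real.holderConjugate_iff.2 ⟨by norm_num, by norm_num⟩ : (2 : ℝ).HolderConjugate 2) hf0 hg0 hfs hgs
  rw [← Real.sqrt_eq_rpow, ← Real.sqrt_eq_rpow] at hcs
  simp_rw [hf2, hg2] at hcs
  exact hle1.trans hcs

omit [DecidableEq d] in
/-- **Interpolation of the spectral weights** (`Ḣ^{2−α}` between `Ḣ¹` and `Ḣ²`): for a nonnegative
lattice sequence `a` with `∑(4π²|k|²)a`, `∑(4π²|k|²)²a` summable and `0 < α < 1`,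
`∑ₖ (4π²|k|²)^{2−α} aₖ ≤ (∑ₖ (4π²|k|²) aₖ)^α (∑ₖ (4π²|k|²)² aₖ)^{1−α}` (Hölder; tree
`Torus.tsum_rpow_mul_le_interpolate`). [folklore] -/
private theorem tsum_weight_rpow_le_interpolate {a : (d → ℤ) → ℝ} (ha : ∀ k, 0 ≤ a k) {α : ℝ}
    (hα0 : 0 < α) (hα1 : α < 1)
    (h1 : Summable fun k : d → ℤ => (4 * Real.pi ^ 2 * freqNormSq k) ^ (1 : ℝ) * a k)
    (h2 : Summable fun k : d → ℤ => (4 * Real.pi ^ 2 * freqNormSq k) ^ (2 : ℝ) * a k) :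
    (Summable fun k : d → ℤ => (4 * Real.pi ^ 2 * freqNormSq k) ^ (2 - α) * a k) ∧
    ∑' k : d → ℤ, (4 * Real.pi ^ 2 * freqNormSq k) ^ (2 - α) * a k ≤
      (∑' k : d → ℤ, (4 * Real.pi ^ 2 * freqNormSq k) ^ (1 : ℝ) * a k) ^ α *
        (∑' k : d → ℤ, (4 * Real.pi ^ 2 * freqNormSq k) ^ (2 : ℝ) * a k) ^ (1 - α) := by
  set c : ℝ := 4 * Real.pi ^ 2 with hc
  have hc0 : 0 < c := by positivity
  -- pass to the `freqNormSq` weights of the tree lemma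
  have hconv : ∀ s : ℝ, (fun k : d → ℤ => (c * freqNormSq k) ^ s * a k) =
      fun k => c ^ s * (freqNormSq k ^ s * a k) := by
    intro s; funext k; rw [Real.mul_rpow hc0.le (freqNormSq_nonneg k), mul_assoc]
  have h1' : Summable fun k : d → ℤ => freqNormSq k ^ (1 : ℝ) * a k := by
    refine (h1.mul_left (c ^ (1 : ℝ))⁻¹).congr fun k => ?_
    rw [Real.mul_rpow hc0.le (freqNormSq_nonneg k), mul_assoc (c ^ (1 : ℝ)),
      inv_mul_cancel_left₀ (Real.rpow_pos_of_pos hc0 _).ne']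
  have h2' : Summable fun k : d → ℤ => freqNormSq k ^ (2 : ℝ) * a k := by
    refine (h2.mul_left (c ^ (2 : ℝ))⁻¹).congr fun k => ?_
    rw [Real.mul_rpow hc0.le (freqNormSq_nonneg k), mul_assoc (c ^ (2 : ℝ)),
      inv_mul_cancel_left₀ (Real.rpow_pos_of_pos hc0 _).ne']
  have hmain := Torus.tsum_rpow_mul_le_interpolate ha (by norm_num : (0 : ℝ) ≤ 1)
    (by norm_num : (1 : ℝ) < 2) hα0 hα1 h1' h2'
  have hexp : α * 1 + (1 - α) * 2 = 2 - α := by ring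
  rw [hexp] at hmain
  obtain ⟨hsum, hle⟩ := hmain
  refine ⟨?_, ?_⟩
  · rw [hconv]
    exact hsum.mul_left _
  · rw [hconv (2 - α), hconv 1, hconv 2, tsum_mul_left, tsum_mul_left, tsum_mul_left,
      Real.mul_rpow (Real.rpow_nonneg hc0.le _) (tsum_nonneg fun k =>
        mul_nonneg (Real.rpow_nonneg (freqNormSq_nonneg k) _) (ha k)),
      Real.mul_rpow (Real.rpow_nonneg hc0.le _) (tsum_nonneg fun k =>
        mul_nonneg (Real.rpow_nonneg (freqNormSq_nonneg k) _) (ha k)),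
      ← Real.rpow_mul hc0.le, ← Real.rpow_mul hc0.le]
    have hcc : c ^ (2 - α) = c ^ ((1 : ℝ) * α) * c ^ ((2 : ℝ) * (1 - α)) := by
      rw [← Real.rpow_add hc0]; congr 1; ring
    rw [hcc]
    have hA0 : 0 ≤ (∑' k : d → ℤ, freqNormSq k ^ (1 : ℝ) * a k) ^ α := Real.rpow_nonneg
      (tsum_nonneg fun k => mul_nonneg (Real.rpow_nonneg (freqNormSq_nonneg k) _) (ha k)) _
    have hB0 : 0 ≤ (∑' k : d → ℤ, freqNormSq k ^ (2 : ℝ) * a k) ^ (1 - α) := Real.rpow_nonneg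
      (tsum_nonneg fun k => mul_nonneg (Real.rpow_nonneg (freqNormSq_nonneg k) _) (ha k)) _
    calc c ^ ((1 : ℝ) * α) * c ^ ((2 : ℝ) * (1 - α)) * ∑' k : d → ℤ, freqNormSq k ^ (2 - α) * a k
        ≤ c ^ ((1 : ℝ) * α) * c ^ ((2 : ℝ) * (1 - α)) *
          ((∑' k : d → ℤ, freqNormSq k ^ (1 : ℝ) * a k) ^ α *
            (∑' k : d → ℤ, freqNormSq k ^ (2 : ℝ) * a k) ^ (1 - α)) :=
          mul_le_mul_of_nonneg_left hle (by positivity)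
      _ = c ^ ((1 : ℝ) * α) * (∑' k : d → ℤ, freqNormSq k ^ (1 : ℝ) * a k) ^ α *
          (c ^ ((2 : ℝ) * (1 - α)) * (∑' k : d → ℤ, freqNormSq k ^ (2 : ℝ) * a k) ^ (1 - α)) := by
          ring

/-! #### Young's inequality with exponents `p = 2/(1+α)`, `q = 2/(1−α)` and the flux bound -/

/-- **Young's inequality in the shape of Miller's proof of Thm 5.3, case `0 < α < 1`**: with
`p = 2/(1+α)`, `q = 2/(1−α)` (`1/p + 1/q = 1`, `q(1−α)/2 = 1`), for `A, B ≥ 0` and `ν > 0`,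
`2 A B^{(1−α)/2} ≤ 2ν B + (1+α)((1−α)/(2ν))^{(1−α)/(1+α)} A^{2/(1+α)}`
(`ab ≤ (a/λ)^p/p + (λb)^q/q` with `λ^q = qν`; `2/p = 1 + α`, `λ^{-p} = (qν)^{-p/q} = ((1−α)/(2ν))^{(1−α)/(1+α)}`).
[folklore] -/
private theorem young_frac {ν α A B : ℝ} (hν : 0 < ν) (hα0 : 0 < α) (hα1 : α < 1)
    (hA : 0 ≤ A) (hB : 0 ≤ B) :
    2 * (A * B ^ ((1 - α) / 2)) ≤
      2 * ν * B + (1 + α) * ((1 - α) / (2 * ν)) ^ ((1 - α) / (1 + α)) * A ^ (2 / (1 + α)) := by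
  have h1α : 0 < 1 - α := by linarith
  have h1α' : 0 < 1 + α := by linarith
  set p : ℝ := 2 / (1 + α) with hp
  set q : ℝ := 2 / (1 - α) with hq
  have hp0 : 0 < p := by positivity
  have hq0 : 0 < q := by positivity
  have hp1 : 1 < p := by
    rw [hp, lt_div_iff₀ h1α']
    linarith
  have hpq : p.HolderConjugate q := by
    refine Real.holderConjugate_iff.2 ⟨hp1, ?_⟩
    simp only [hp, hq]
    field_simp
    ring
  set lam : ℝ := (q * ν) ^ (1 / q) with hlam
  have hqν : 0 < q * ν := by positivity
  have hlam0 : 0 < lam := Real.rpow_pos_of_pos hqν _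
  have hBe : 0 ≤ B ^ ((1 - α) / 2) := Real.rpow_nonneg hB _
  have hy := Real.young_inequality_of_nonneg (a := A / lam) (b := lam * B ^ ((1 - α) / 2))
    (by positivity) (by positivity) hpq
  have lhs : A / lam * (lam * B ^ ((1 - α) / 2)) = A * B ^ ((1 - α) / 2) := by
    field_simp
  have hBq : (B ^ ((1 - α) / 2)) ^ q = B := by
    rw [← Real.rpow_mul hB]
    have : (1 - α) / 2 * q = 1 := by
      simp only [hq]
      field_simp
    rw [this, Real.rpow_one]
  have hlamq : lam ^ q = q * ν := by
    simp only [hlam]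
    rw [← Real.rpow_mul hqν.le, one_div_mul_cancel hq0.ne', Real.rpow_one]
  have rhs2 : (lam * B ^ ((1 - α) / 2)) ^ q / q = ν * B := by
    rw [Real.mul_rpow hlam0.le hBe, hBq, hlamq]
    field_simp
  have hAp : (A / lam) ^ p = A ^ p * (lam ^ p)⁻¹ := by
    rw [Real.div_rpow hA hlam0.le, div_eq_mul_inv]
  have hlamp : lam ^ p = (q * ν) ^ ((1 - α) / (1 + α)) := by
    simp only [hlam]
    rw [← Real.rpow_mul hqν.le]
    congr 1
    simp only [hp, hq]
    field_simp
  have hinv : ((q * ν) ^ ((1 - α) / (1 + α)))⁻¹ = ((1 - α) / (2 * ν)) ^ ((1 - α) / (1 + α)) := by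
    rw [← Real.inv_rpow hqν.le]
    congr 1
    simp only [hq]
    field_simp
  have h2p : 2 / p = 1 + α := by
    simp only [hp]
    field_simp
  calc 2 * (A * B ^ ((1 - α) / 2)) = 2 * (A / lam * (lam * B ^ ((1 - α) / 2))) := by rw [lhs]
    _ ≤ 2 * ((A / lam) ^ p / p + (lam * B ^ ((1 - α) / 2)) ^ q / q) := by linarith [hy]
    _ = 2 * ν * B + 2 / p * (lam ^ p)⁻¹ * A ^ p := by
        rw [rhs2, hAp]
        field_simp
        ring
    _ = 2 * ν * B + (1 + α) * ((1 - α) / (2 * ν)) ^ ((1 - α) / (1 + α)) * A ^ (2 / (1 + α)) := by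
        rw [h2p, hlamp, hinv]

/-- **The flux of the `Ḣ¹`-strain balance for `0 < α < 1`** (Miller, Pure Appl. Anal. 8 (2026),
proof of Thm 5.3, general case: "Using the duality of `Ḣ^α` and `Ḣ^{-α}`, and interpolating between
`Ḣ^{-1}` and `L²` we find that `d/dt ½‖S‖²_{Ḣ¹} ≤ −‖−ΔS‖² + ‖S‖^α_{Ḣ¹}‖−ΔS‖^{1−α}_{L²}‖Q‖_{Ḣ^α}`
… Applying Young's inequality with exponents `p` and `q`, we find that
`d/dt ½‖S‖²_{Ḣ¹} ≤ (C_α/2)‖Q‖^p_{Ḣ^α}‖S‖^{αp}_{Ḣ¹}`"): for a smooth divergence-free `v` on `T³`,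
`ν > 0`, `0 < α < 1`, frame `e`, with `X = ½‖Δv‖₂² = ‖S‖²_{Ḣ¹}` and
`‖Q‖_{Ḣ^α} = (Torus.matrixHsSeminormSq α (P_{st} strainPerturbation))^{1/2}`:
`−ν‖∇Δv‖₂² + 2⟨ΔS, P_{st}Q̃⟩ ≤ C_α(ν) · X^{α/(1+α)} · ‖Q‖^{2/(1+α)}_{Ḣ^α}`,
with the explicit constant `C_α(ν) = (1+α)((1−α)/(2ν))^{(1−α)/(1+α)}` produced by the printed
Young step (`C₀(ν) = (2ν)⁻¹`, and `C_α(1) → 2 = C₁` as `α → 1`; the paper only records that `C_α`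
depends on `α`). [cite: Miller2026StrainVorticity, Thm 5.3 (= Thm 1.8), proof, case 0 < α < 1] -/
theorem strainH1Flux_le_frac (e : d ≃ Fin 3) {ν α : ℝ} (hν : 0 < ν) (hα0 : 0 < α) (hα1 : α < 1)
    {v : UnitAddTorus d → EuclideanSpace ℝ d} (hv : Torus.IsSmooth v) (hdiv : Torus.IsDivFree v) :
    -ν * Torus.gradNormSq (Torus.laplacian v) +
        2 * ∫ x, ∑ a, ∑ b, ((Torus.partialDeriv a (Torus.laplacian v) x b +
          Torus.partialDeriv b (Torus.laplacian v) x a) / 2) *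
          Torus.strainProjection (Torus.strainPerturbation e v) a b x ≤
      ((1 + α) * ((1 - α) / (2 * ν)) ^ ((1 - α) / (1 + α))) *
        ((2⁻¹ * ∫ x, ‖Torus.laplacian v x‖ ^ 2) ^ (α / (1 + α)) *
          Real.sqrt (Torus.matrixHsSeminormSq α
            (Torus.strainProjection (Torus.strainPerturbation e v))) ^ (2 / (1 + α))) := by
  have h1α' : 0 < 1 + α := by linarith
  have hM := Torus.isSmooth_strainPerturbation e hv
  have hQ := Torus.isSmooth_strainProjection hM
  have hS := isSmooth_strainM hv
  set Q : d → d → UnitAddTorus d → ℝ := Torus.strainProjection (Torus.strainPerturbation e v) with hQdef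
  set X : ℝ := 2⁻¹ * ∫ x, ‖Torus.laplacian v x‖ ^ 2 with hX
  set B : ℝ := ∫ x, ∑ a, ∑ b, ((Torus.partialDeriv a (Torus.laplacian v) x b +
    Torus.partialDeriv b (Torus.laplacian v) x a) / 2) ^ 2 with hB
  set qn : ℝ := Real.sqrt (Torus.matrixHsSeminormSq α Q) with hqn
  have hX0 : 0 ≤ X := mul_nonneg (by norm_num) (integral_nonneg fun x => sq_nonneg _)
  have hB0 : 0 ≤ B := integral_nonneg fun x =>
    Finset.sum_nonneg fun a _ => Finset.sum_nonneg fun b _ => sq_nonneg _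
  have hqn0 : 0 ≤ qn := Real.sqrt_nonneg _
  have hBG : B = 2⁻¹ * Torus.gradNormSq (Torus.laplacian v) :=
    StrainAlmostEigen.integral_sum_laplacianStrain_sq_eq hv hdiv
  -- the Fourier data of the strain rows
  set W : (d → ℤ) → ℝ := fun k => 4 * Real.pi ^ 2 * freqNormSq k with hW
  set cS : d → (d → ℤ) → ℝ := fun a k =>
    ‖mFourierCoeff (EuclideanSpace.complexify ∘ mrow (strainM v) a) k‖ ^ 2 with hcS
  set aseq : (d → ℤ) → ℝ := fun k => ∑ a, cS a k with haseq
  have hcS0 : ∀ a k, 0 ≤ cS a k := fun a k => sq_nonneg _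
  have ha0 : ∀ k, 0 ≤ aseq k := fun k => Finset.sum_nonneg fun a _ => hcS0 a k
  have hsumS : ∀ (s : ℝ), 0 ≤ s → ∀ a, Summable fun k => W k ^ s * cS a k := fun s hs a =>
    summable_weight_rpow_mul (isSmooth_mrow hS a) hs
  -- `∑ₐ ∑ₖ Wˢ cS a k = ∑ₖ Wˢ aseq k`
  have hswap : ∀ (s : ℝ), 0 ≤ s → ∑ a, ∑' k, W k ^ s * cS a k = ∑' k, W k ^ s * aseq k := by
    intro s hs
    rw [← Summable.tsum_finsetSum fun a _ => hsumS s hs a]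
    exact tsum_congr fun k => by rw [haseq, Finset.mul_sum]
  have hsumA : ∀ (s : ℝ), 0 ≤ s → Summable fun k => W k ^ s * aseq k := by
    intro s hs
    refine (summable_sum fun a (_ : a ∈ Finset.univ) => hsumS s hs a).congr fun k => ?_
    rw [haseq, Finset.mul_sum]
  -- levels one and two of the strain: `X` and `B`
  have hN1 : ∑' k, W k ^ (1 : ℝ) * aseq k = X := by
    rw [← hswap 1 zero_le_one, hX, ← Torus.matrixHsSeminormSq_one_symGrad hv hdiv]
    rfl
  have hN2 : ∑' k, W k ^ (2 : ℝ) * aseq k = B := by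
    rw [← hswap 2 (by norm_num), hB, ← Torus.matrixHsSeminormSq_two_symGrad hv]
    rfl
  -- interpolation `N_{2−α} ≤ X^α B^{1−α}`
  have hinterp := tsum_weight_rpow_le_interpolate ha0 hα0 hα1 (hsumA 1 zero_le_one) (hsumA 2 (by norm_num))
  rw [hN1, hN2] at hinterp
  obtain ⟨-, hNle⟩ := hinterp
  -- pairing, row by row
  have hpair : ∫ x, ∑ a, ∑ b, ((Torus.partialDeriv a (Torus.laplacian v) x b +
      Torus.partialDeriv b (Torus.laplacian v) x a) / 2) * Q a b x ≤
      Real.sqrt (∑' k, W k ^ (2 - α) * aseq k) * qn := by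
    rw [integral_sum_laplacianStrain_mul_eq_sum_inner hv hQ]
    have hrow : ∀ a, ∫ x, ⟪Torus.laplacian (mrow (strainM v) a) x, mrow Q a x⟫ ≤
        Real.sqrt (∑' k, W k ^ (2 - α) * cS a k) *
          Real.sqrt (∑' k, W k ^ α * ‖mFourierCoeff (EuclideanSpace.complexify ∘ mrow Q a) k‖ ^ 2) :=
      fun a => integral_inner_laplacian_le_sqrt_mul_sqrt (isSmooth_mrow hS a) (isSmooth_mrow hQ a)
        hα0 (by linarith)
    refine (Finset.sum_le_sum fun a _ => hrow a).trans ?_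
    refine (Real.sum_sqrt_mul_sqrt_le _ (fun a => tsum_nonneg fun k =>
      mul_nonneg (Real.rpow_nonneg (weight_nonneg k) _) (hcS0 a k))
      (fun a => tsum_nonneg fun k => mul_nonneg (Real.rpow_nonneg (weight_nonneg k) _) (sq_nonneg _))).trans ?_
    rw [hswap (2 - α) (by linarith), hqn, matrixHsSeminormSq_eq]
  -- `√(N_{2−α}) ≤ X^{α/2} B^{(1−α)/2}`
  have hsqrtN : Real.sqrt (∑' k, W k ^ (2 - α) * aseq k) ≤ X ^ (α / 2) * B ^ ((1 - α) / 2) := by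
    calc Real.sqrt (∑' k, W k ^ (2 - α) * aseq k) ≤ Real.sqrt (X ^ α * B ^ (1 - α)) :=
          Real.sqrt_le_sqrt hNle
      _ = X ^ (α / 2) * B ^ ((1 - α) / 2) := by
          rw [Real.sqrt_eq_rpow, Real.mul_rpow (Real.rpow_nonneg hX0 _) (Real.rpow_nonneg hB0 _),
            ← Real.rpow_mul hX0, ← Real.rpow_mul hB0]
          congr 2 <;> ring
  have hP : ∫ x, ∑ a, ∑ b, ((Torus.partialDeriv a (Torus.laplacian v) x b +
      Torus.partialDeriv b (Torus.laplacian v) x a) / 2) * Q a b x ≤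
      (X ^ (α / 2) * qn) * B ^ ((1 - α) / 2) := by
    calc _ ≤ Real.sqrt (∑' k, W k ^ (2 - α) * aseq k) * qn := hpair
      _ ≤ (X ^ (α / 2) * B ^ ((1 - α) / 2)) * qn := mul_le_mul_of_nonneg_right hsqrtN hqn0
      _ = (X ^ (α / 2) * qn) * B ^ ((1 - α) / 2) := by ring
  -- Young
  have hA0 : 0 ≤ X ^ (α / 2) * qn := mul_nonneg (Real.rpow_nonneg hX0 _) hqn0
  have hyoung := young_frac hν hα0 hα1 hA0 hB0
  have hAp : (X ^ (α / 2) * qn) ^ (2 / (1 + α)) = X ^ (α / (1 + α)) * qn ^ (2 / (1 + α)) := by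
    rw [Real.mul_rpow (Real.rpow_nonneg hX0 _) hqn0, ← Real.rpow_mul hX0]
    congr 2
    field_simp
  rw [hAp] at hyoung
  have hC0 : 0 ≤ (1 + α) * ((1 - α) / (2 * ν)) ^ ((1 - α) / (1 + α)) :=
    mul_nonneg h1α'.le (Real.rpow_nonneg (by positivity) _)
  calc -ν * Torus.gradNormSq (Torus.laplacian v) +
        2 * ∫ x, ∑ a, ∑ b, ((Torus.partialDeriv a (Torus.laplacian v) x b +
          Torus.partialDeriv b (Torus.laplacian v) x a) / 2) * Q a b x
      = -(2 * ν * B) + 2 * ∫ x, ∑ a, ∑ b, ((Torus.partialDeriv a (Torus.laplacian v) x b +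
          Torus.partialDeriv b (Torus.laplacian v) x a) / 2) * Q a b x := by rw [hBG]; ring
    _ ≤ -(2 * ν * B) + 2 * ((X ^ (α / 2) * qn) * B ^ ((1 - α) / 2)) := by linarith [hP]
    _ ≤ (1 + α) * ((1 - α) / (2 * ν)) ^ ((1 - α) / (1 + α)) *
          (X ^ (α / (1 + α)) * qn ^ (2 / (1 + α))) := by linarith [hyoung]

end StrainProjectionCriterion

/-! ### Theorem 1.8 (`0 < α < 1`): Grönwall and continuation forms -/

/-- **Miller's Theorem 1.8 for `0 < α < 1` (`p = 2/(1+α)`), Grönwall form on `T³`** (Pure Appl. Anal. 8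
(2026), Thm 1.8 = Thm 5.3: "Suppose `0 ≤ α ≤ 1` and `p = 2/(1+α)`. Then for all `0 < t < T_max`,
`‖S(·,t)‖²_{Ḣ¹} ≤ ‖S⁰‖²_{Ḣ¹} exp(C_α ∫₀ᵗ ‖P_{st}((u·∇)S + S² + ¾ω⊗ω)(·,τ)‖^p_{Ḣ^α}/‖S(·,τ)‖^p_{Ḣ¹} dτ)`,
where `C_α` depends only on `α`"). Along a classical solution of the unforced Navier–Stokes equations
with `ν > 0` on `[a, b] × T^d` (`card d = 3`, frame `e`, `Q(s) = P_{st}(strainPerturbation)(s)`,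
`‖Q‖_{Ḣ^α} = (Torus.matrixHsSeminormSq α Q)^{1/2}`, `‖S‖_{Ḣ¹} = (½‖Δu‖₂²)^{1/2}`), if `Λ` is
continuous on `[a, b]` with `‖Q(s)‖^p_{Ḣ^α} ≤ Λ(s) ‖S(s)‖^p_{Ḣ¹}` for all `s ∈ [a, b]` (`Λ` is the
printed integrand), then `½‖Δu(t)‖₂² ≤ ½‖Δu(a)‖₂² · exp(C_α(ν) ∫ₐᵗ Λ)` for every `t ∈ [a, b]`, with
the explicit constant `C_α(ν) = (1+α)((1−α)/(2ν))^{(1−α)/(1+α)}` of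
`StrainProjectionCriterion.strainH1Flux_le_frac` (`= ½` at `α = 0`, `ν = 1`, the printed `C₀`).
[cite: Miller2026StrainVorticity, Thm 1.8 (= Thm 5.3), case 0 < α < 1] -/
theorem Torus.half_laplacianSq_le_mul_exp_integral_of_strainProjection_frac_le (hd : Fintype.card d = 3)
    (e : d ≃ Fin 3) {ν α a b : ℝ} (hν : 0 < ν) (hα0 : 0 < α) (hα1 : α < 1) (hab : a < b)
    {u : ℝ → UnitAddTorus d → EuclideanSpace ℝ d} {p : ℝ → UnitAddTorus d → ℝ}
    (h : Torus.IsClassicalNSSolutionOn (Icc a b) ν 0 u p)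
    {Λ : ℝ → ℝ} (hΛc : ContinuousOn Λ (Icc a b))
    (hΛ : ∀ s ∈ Icc a b,
      Real.sqrt (Torus.matrixHsSeminormSq α
          (Torus.strainProjection (Torus.strainPerturbation e (u s)))) ^ (2 / (1 + α)) ≤
        Λ s * Real.sqrt (2⁻¹ * ∫ x, ‖Torus.laplacian (u s) x‖ ^ 2) ^ (2 / (1 + α)))
    {t : ℝ} (ht : t ∈ Icc a b) :
    2⁻¹ * ∫ x, ‖Torus.laplacian (u t) x‖ ^ 2 ≤
      (2⁻¹ * ∫ x, ‖Torus.laplacian (u a) x‖ ^ 2) *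
        Real.exp (((1 + α) * ((1 - α) / (2 * ν)) ^ ((1 - α) / (1 + α))) * ∫ s in a..t, Λ s) := by
  have h1α' : 0 < 1 + α := by linarith
  set C : ℝ := (1 + α) * ((1 - α) / (2 * ν)) ^ ((1 - α) / (1 + α)) with hC
  have hC0 : 0 ≤ C := mul_nonneg h1α'.le (Real.rpow_nonneg (by positivity) _)
  set G : ℝ → ℝ := fun s => -ν * Torus.gradNormSq (Torus.laplacian (u s)) +
    2 * ∫ x, ∑ i, ∑ j, ((Torus.partialDeriv i (Torus.laplacian (u s)) x j +
      Torus.partialDeriv j (Torus.laplacian (u s)) x i) / 2) *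
      Torus.strainProjection (Torus.strainPerturbation e (u s)) i j x with hG
  have hder : ∀ s ∈ Icc a b, HasDerivWithinAt (fun r => 2⁻¹ * ∫ x, ‖Torus.laplacian (u r) x‖ ^ 2)
      (G s) (Icc a b) s := fun s hs => h.hasDerivWithinAt_half_laplacianSq_strainProjection hd e hab hs
  have hle : ∀ s ∈ Icc a b, G s ≤ (C * Λ s) * (2⁻¹ * ∫ x, ‖Torus.laplacian (u s) x‖ ^ 2) := by
    intro s hs
    have hus : Torus.IsSmooth (u s) := h.smooth_velocity.isSmooth_slice hs
    have h1 := strainH1Flux_le_frac e hν hα0 hα1 hus (h.divFree s hs)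
    set F : ℝ := 2⁻¹ * ∫ x, ‖Torus.laplacian (u s) x‖ ^ 2 with hF
    set qn : ℝ := Real.sqrt (Torus.matrixHsSeminormSq α
      (Torus.strainProjection (Torus.strainPerturbation e (u s)))) with hqn
    have hF0 : 0 ≤ F := mul_nonneg (by norm_num) (integral_nonneg fun x => sq_nonneg _)
    -- `qn^p ≤ Λ (√F)^p = Λ F^{1/(1+α)}` and `F^{α/(1+α)} F^{1/(1+α)} = F`
    have hsqF : Real.sqrt F ^ (2 / (1 + α)) = F ^ (1 / (1 + α)) := by
      rw [Real.sqrt_eq_rpow, ← Real.rpow_mul hF0]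
      congr 1
      field_simp
    have h2 : F ^ (α / (1 + α)) * qn ^ (2 / (1 + α)) ≤ F ^ (α / (1 + α)) * (Λ s * F ^ (1 / (1 + α))) := by
      have := hΛ s hs
      rw [hsqF] at this
      exact mul_le_mul_of_nonneg_left this (Real.rpow_nonneg hF0 _)
    have h3 : F ^ (α / (1 + α)) * (Λ s * F ^ (1 / (1 + α))) = Λ s * F := by
      have hFF : F ^ (α / (1 + α)) * F ^ (1 / (1 + α)) = F := by
        have hsum1 : α / (1 + α) + 1 / (1 + α) = 1 := by
          rw [← add_div, add_comm, div_self h1α'.ne']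
        rw [← Real.rpow_add' hF0 (by rw [hsum1]; exact one_ne_zero), hsum1, Real.rpow_one]
      calc F ^ (α / (1 + α)) * (Λ s * F ^ (1 / (1 + α)))
          = Λ s * (F ^ (α / (1 + α)) * F ^ (1 / (1 + α))) := by ring
        _ = Λ s * F := by rw [hFF]
    have h4 : C * (F ^ (α / (1 + α)) * qn ^ (2 / (1 + α))) ≤ C * (Λ s * F) := by
      rw [← h3]
      exact mul_le_mul_of_nonneg_left h2 hC0
    simp only [hG]
    calc _ ≤ C * (F ^ (α / (1 + α)) * qn ^ (2 / (1 + α))) := h1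
      _ ≤ C * (Λ s * F) := h4
      _ = C * Λ s * F := by ring
  have hk : ContinuousOn (fun s => C * Λ s) (Icc a b) := continuousOn_const.mul hΛc
  have hmain := le_mul_exp_integral_of_hasDerivWithinAt_le_mul hab hder hk hle ht
  rwa [intervalIntegral.integral_const_mul] at hmain

/-- **Miller's Theorem 1.8 for `0 < α < 1`, continuation form on `T³`** ("in particular, if
`T_max < +∞` then `∫₀^{T_max} ‖Q‖^p_{Ḣ^α}/‖S‖^p_{Ḣ¹} dt = +∞`", Pure Appl. Anal. 8 (2026), (1.28)):
a classical solution of the unforced Navier–Stokes equations (`ν > 0`) on `[0, T) × T^d`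
(`card d = 3`, `T > 0`, mean-zero slices) for which some continuous `Λ` on `[0, T)` satisfies
`‖Q(t)‖^p_{Ḣ^α} ≤ Λ(t) ‖S(t)‖^p_{Ḣ¹}` (`p = 2/(1+α)`) and `∫₀ᵗ Λ ≤ I` for all `t ∈ [0, T)` continues to
a classical solution on some `[0, T']`, `T' > T`.
[cite: Miller2026StrainVorticity, Thm 1.8 (= Thm 5.3), case 0 < α < 1, display (1.28)] -/
theorem Torus.classicalNS_continuation_of_strainProjection_frac_integral_le (hd : Fintype.card d = 3)
    (e : d ≃ Fin 3) {ν α T : ℝ} (hν : 0 < ν) (hα0 : 0 < α) (hα1 : α < 1) (hT : 0 < T)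
    {u : ℝ → UnitAddTorus d → EuclideanSpace ℝ d} {p : ℝ → UnitAddTorus d → ℝ}
    (h : Torus.IsClassicalNSSolutionOn (Ico 0 T) ν 0 u p)
    (hmean : ∀ t ∈ Ico 0 T, Torus.HasZeroMean (u t)) {Λ : ℝ → ℝ}
    (hΛc : ContinuousOn Λ (Ico 0 T))
    (hΛ : ∀ t ∈ Ico 0 T,
      Real.sqrt (Torus.matrixHsSeminormSq α
          (Torus.strainProjection (Torus.strainPerturbation e (u t)))) ^ (2 / (1 + α)) ≤
        Λ t * Real.sqrt (2⁻¹ * ∫ x, ‖Torus.laplacian (u t) x‖ ^ 2) ^ (2 / (1 + α)))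
    {I : ℝ} (hI : ∀ t ∈ Ico 0 T, ∫ s in (0 : ℝ)..t, Λ s ≤ I) :
    ∃ T' : ℝ, T < T' ∧ ∃ (u' : ℝ → UnitAddTorus d → EuclideanSpace ℝ d)
      (p' : ℝ → UnitAddTorus d → ℝ), Torus.IsClassicalNSSolutionOn (Icc 0 T') ν 0 u' p' ∧
        (∀ t ∈ Icc 0 T', Torus.HasZeroMean (u' t)) ∧ ∀ t ∈ Ico 0 T, u' t = u t := by
  have h1α' : 0 < 1 + α := by linarith
  set C : ℝ := (1 + α) * ((1 - α) / (2 * ν)) ^ ((1 - α) / (1 + α)) with hC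
  have hC0 : 0 ≤ C := mul_nonneg h1α'.le (Real.rpow_nonneg (by positivity) _)
  have hI0 : 0 ≤ I := by
    have h0 := hI 0 ⟨le_rfl, hT⟩
    rwa [intervalIntegral.integral_same] at h0
  set F0 : ℝ := 2⁻¹ * ∫ x, ‖Torus.laplacian (u 0) x‖ ^ 2 with hF0
  have hF00 : 0 ≤ F0 := mul_nonneg (by norm_num) (integral_nonneg fun x => sq_nonneg _)
  refine Torus.classicalNS_continuation_of_half_laplacianSq_le hd hν hT h hmean
    (B := F0 * Real.exp (C * I)) fun t ht => ?_
  rcases ht.1.eq_or_lt with h0 | h0t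
  · rw [← h0]
    exact le_mul_of_one_le_right hF00 (Real.one_le_exp (by positivity))
  · have hsub : Icc 0 t ⊆ Ico 0 T := fun s hs => ⟨hs.1, hs.2.trans_lt ht.2⟩
    have ht' : Torus.IsClassicalNSSolutionOn (Icc 0 t) ν 0 u p := h.mono hsub (uniqueDiffOn_Icc h0t)
    have hmain := Torus.half_laplacianSq_le_mul_exp_integral_of_strainProjection_frac_le hd e hν hα0 hα1
      h0t ht' (hΛc.mono hsub) (fun s hs => hΛ s (hsub hs)) ⟨h0t.le, le_rfl⟩
    have hexp : Real.exp (C * ∫ s in (0 : ℝ)..t, Λ s) ≤ Real.exp (C * I) :=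
      Real.exp_le_exp.2 (mul_le_mul_of_nonneg_left (hI t ht) hC0)
    exact hmain.trans (mul_le_mul_of_nonneg_left hexp hF00)

end Literature.Analysis.FluidPDE
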